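import Literature.MathematicalPhysics.QuantumManyBody.DyadicCoherentFraction
import Literature.MathematicalPhysics.QuantumManyBody.NeumannBoseGasCondensationProofs
import Literature.MathematicalPhysics.QuantumManyBody.BoseGasFreeDirichletBEC
import Literature.MathematicalPhysics.QuantumManyBody.EnergyLocalizationCellMethod
import HarnessLib

/-!
# Local condensation of Dirichlet states into sub-cell constant modes (LSSY's mechanism, cell by cell)

Topic `Literature/MathematicalPhysics/QuantumManyBody`, namespace `…BoseGas` (support of the
crux `BECTangentRigidity.TangentTransfer`, stmt-AtomisticToContinuum-13033, of the summit
`AtomisticToContinuum/BoseEinsteinCondensation`: the "mesoscopic floor" of Dirichlet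
near-minimisers).  Carriers: the Dirichlet trial states `TrialState N L` of `Λ_L = (0,L)³`, the
sub-cells `subCell s q` (`q : SubIdx K`, side `s`, `L = Ks`) and their constant modes
`subMode s q` of `BoseGasFreeDirichletBEC.lean`, the cell method of `LiebYngvasonCellMethod.lean`
(`cellSet K s σ`, `kineticOn`, `interactionOn`, `neumannGroundStateEnergy`), the localized
functional of `EnergyLocalization*.lean` (`locGroundStateEnergy`, `locDensityOn`, `nearSetOn`) and
the dyadic coherent sum `cohSum` of `DyadicCoherentFraction.lean`.

## Content

The proof of [LSSY2005, Thm. 5.1] (BEC in the Gross–Pitaevskii limit, (5.15)–(5.17): the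
generalized Poincaré inequality Lemma 4.1 applied to the one-particle slices of the ground state,
with the balls around the other particles removed, and the localization of energy Lemma 5.2) is
run SUB-CELL BY SUB-CELL on a big Dirichlet box divided into `K³` cells of side `s`, for an
arbitrary `C¹` Dirichlet state, with a configuration-dependent excluded volume (only the balls
around the particles of the SAME cell are removed, so that the "outside" kinetic energy is the one
controlled by Lemma 5.2 applied to that cell's group of particles):

* Part A — the variance identity and Lemma 4.1 on translated cells; the half-open cell sets
  `{X | ∀ j, X j ∈ subCell s (cellCoord K (σ j))}` of an assignment `σ : Fin N → Fin (K³)` (an exact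
  measurable partition of `[0,L)^{3N}`, a.e. equal to the open `cellSet K s σ`); the sub-cell
  depletion identity `∑_q ⟨u_q, γ_Ψ u_q⟩ + depletion = N` (`occupation_add_depletion_eq`, (5.17) per
  sub-cell, in the redundant-variable normalisation of `PeriodicBoseGasThm31.lean`);
* Part B — the slice bound `depletion ≤ C (s² 𝒯^out + w 𝒦) + 𝒩^bad` (`depletion_le_cellSet_sums`):
  Lemma 4.1 on each sub-cell of each slice when the occupation of the sub-cell is `good`, the
  trivial bound otherwise, integrated and re-summed over the cell sets;
* Part C — the energy bookkeeping on the cell sets: `E'(ε,R; n_c, s)·mass + (1-ε) T^out_c ≤ T_c + I_c`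
  (localized group extraction keeping the outside kinetic energy), `E₀^Neu(n_c,s)·mass ≤ T_c + I_c`,
  `∑_σ ∑_c (T_c + I_c) ≤ ⟨Ψ,HΨ⟩`, `∑_σ mass_σ = 1`, fibrewise re-indexing;
* Part M — the deterministic floor inequality `seven_eighths_le_sum_occupation`: if the cell
  functionals are bounded below as prescribed for good / other occupation numbers, the occupation
  bookkeeping `A + κ·N^bad ≤ ∑_c lb(n_c) + B` holds for every distribution of the particles,
  `2Cs²κ ≥ 1` and `2Cs²(U + B - A) + CwU ≤ N/8`, then `7N/8 ≤ ∑_q ⟨u_q, γ_Ψ u_q⟩`;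
* `sum_occupation_subMode_eq_cohSum` — with `s = L/2^k` the sub-cell occupations are the dyadic
  coherent sum `cohSum N L k`.

All statements are about arbitrary `C¹` functions / Dirichlet states and explicit real parameters;
no limits are taken here and no definitions are introduced (the analytic choice of the parameters
in the dilute limit is left to the user).

## References

* [LSSY2005] E. H. Lieb, R. Seiringer, J. P. Solovej, J. Yngvason, *The Mathematics of the Bose
  Gas and its Condensation*, Oberwolfach Seminars 34, Birkhäuser 2005 (arXiv:cond-mat/0610117):
  Lemma 4.1 (4.2), Lemma 5.2 (5.7)–(5.14), proof of Thm. 5.1 (5.15)–(5.17), (2.52)–(2.53).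
* [LiebSeiringer2002] E. H. Lieb, R. Seiringer, *Proof of Bose–Einstein condensation for dilute
  trapped gases*, Phys. Rev. Lett. 88 (2002) 170409.
-/

noncomputable section

open MeasureTheory Filter Set Metric
open scoped ENNReal NNReal Topology BigOperators

namespace Literature.MathematicalPhysics.QuantumManyBody.BoseGas

open Literature.Barriers.AtomisticToContinuum.BoseGas (lintegral_nnnorm_sq_cell_eq)

/-! ### Translated cells: volume, variance identity, Lemma 4.1 -/

section Translate

variable {s : ℝ}

/-- `[0,s)³ = (· + a)⁻¹' (a + [0,s)³)`. [folklore] -/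
theorem cell_eq_preimage_cellShift (s : ℝ) (a : Space) :
    cell s = (fun x => x + a) ⁻¹' cellShift s a := by
  ext x; simp [cellShift]

/-- Translated cells have volume `s³` (the lemma `volume_cellShift` of
`BoseGasCutoffStateOccupation.lean`, re-proved here to keep the imports light). [folklore] -/
theorem volume_cellShift_eq_pow (s : ℝ) (a : Space) : volume (cellShift s a) = ENNReal.ofReal s ^ 3 := by
  rw [← volume_cell, cell_eq_preimage_cellShift s a]
  exact (measure_preimage_add_right (volume : Measure Space) a (cellShift s a)).symm

/-- Translating the average: `⨍_{[0,s)³} f(y + a) dy = ⨍_{a+[0,s)³} f`. [folklore] -/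
theorem setAverage_cell_comp_add (s : ℝ) (f : Space → ℂ) (a : Space) :
    ⨍ y in cell s, f (y + a) = ⨍ y in cellShift s a, f y := by
  rw [setAverage_eq, setAverage_eq, setIntegral_cell_comp_add, measureReal_def, measureReal_def,
    volume_cell, volume_cellShift_eq_pow]

/-- **Variance identity on a translated cell**:
`∫_Q |f|² = ∫_Q |f - ⟨f⟩_Q|² + s⁻³ |∫_Q f|²`, `Q = a + [0,s)³`. [folklore] -/
theorem lintegral_nnnorm_sq_cellShift_eq (hs : 0 < s) {φ : Space → ℂ} (hφ : Continuous φ)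
    (a : Space) :
    ∫⁻ x in cellShift s a, (‖φ x‖₊ : ℝ≥0∞) ^ 2 =
      (∫⁻ x in cellShift s a, (‖φ x - ⨍ y in cellShift s a, φ y‖₊ : ℝ≥0∞) ^ 2) +
        (ENNReal.ofReal s ^ 3)⁻¹ * (‖∫ x in cellShift s a, φ x‖₊ : ℝ≥0∞) ^ 2 := by
  have hc : Continuous fun y : Space => φ (y + a) := hφ.comp (continuous_id.add continuous_const)
  have h := lintegral_nnnorm_sq_cell_eq hs hc
  rw [setAverage_cell_comp_add s φ a, setIntegral_cell_comp_add s φ a,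
    setLIntegral_cell_comp_add s (fun x => (‖φ x‖₊ : ℝ≥0∞) ^ 2) a,
    setLIntegral_cell_comp_add s (fun x => (‖φ x - ⨍ y in cellShift s a, φ y‖₊ : ℝ≥0∞) ^ 2) a] at h
  exact h

/-- **LSSY Lemma 4.1 on a translated cell.** If the generalized Poincaré inequality holds on
`[0,s)³` with constant `C`, it holds on every translate `Q = a + [0,s)³`:
`∫_Q |f - ⟨f⟩_Q|² ≤ C (s² ∫_Ω |∇f|² + |Q ∖ Ω|^{2/3} ∫_Q |∇f|²)` for measurable `Ω ⊆ Q`. [folklore] -/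
theorem lemma41_cellShift {C : ℝ}
    (h41 : ∀ (L : ℝ), 0 < L → ∀ (f : Space → ℂ), ContDiff ℝ 1 f →
      ∀ (Ω : Set Space), MeasurableSet Ω → Ω ⊆ cell L →
        ∫⁻ x in cell L, (‖f x - ⨍ y in cell L, f y‖₊ : ℝ≥0∞) ^ 2 ≤
          ENNReal.ofReal C *
            (ENNReal.ofReal (L ^ 2) * (∫⁻ x in Ω, gradSqC f x) +
              volume (cell L \ Ω) ^ (2 / 3 : ℝ) * ∫⁻ x in cell L, gradSqC f x))
    (hs : 0 < s) {f : Space → ℂ} (hf : ContDiff ℝ 1 f) (a : Space) {Ω : Set Space}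
    (hΩ : MeasurableSet Ω) (hΩQ : Ω ⊆ cellShift s a) :
    ∫⁻ x in cellShift s a, (‖f x - ⨍ y in cellShift s a, f y‖₊ : ℝ≥0∞) ^ 2 ≤
      ENNReal.ofReal C *
        (ENNReal.ofReal (s ^ 2) * (∫⁻ x in Ω, gradSqC f x) +
          volume (cellShift s a \ Ω) ^ (2 / 3 : ℝ) * ∫⁻ x in cellShift s a, gradSqC f x) := by
  set g : Space → ℂ := fun y => f (y + a) with hg
  have hgd : ContDiff ℝ 1 g := hf.comp (contDiff_id.add contDiff_const)
  set Ω' : Set Space := (fun x => x + a) ⁻¹' Ω with hΩ'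
  have hΩ'm : MeasurableSet Ω' := hΩ.preimage (measurable_id.add_const a)
  have hΩ'c : Ω' ⊆ cell s := by
    intro x hx
    rw [cell_eq_preimage_cellShift s a]
    exact hΩQ hx
  have h := h41 s hs g hgd Ω' hΩ'm hΩ'c
  have hmp := measurePreserving_add_right (volume : Measure Space) a
  -- translate every term
  have h1 : ∫⁻ x in cell s, (‖g x - ⨍ y in cell s, g y‖₊ : ℝ≥0∞) ^ 2 =
      ∫⁻ x in cellShift s a, (‖f x - ⨍ y in cellShift s a, f y‖₊ : ℝ≥0∞) ^ 2 := by
    rw [hg, setAverage_cell_comp_add s f a]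
    exact setLIntegral_cell_comp_add s (fun x => (‖f x - ⨍ y in cellShift s a, f y‖₊ : ℝ≥0∞) ^ 2) a
  have h2 : ∫⁻ x in Ω', gradSqC g x = ∫⁻ x in Ω, gradSqC f x := by
    simp only [hg, gradSqC_comp_add]
    exact hmp.setLIntegral_comp_preimage_emb (measurableEmbedding_addRight a) (gradSqC f) Ω
  have h3 : ∫⁻ x in cell s, gradSqC g x = ∫⁻ x in cellShift s a, gradSqC f x := by
    simp only [hg, gradSqC_comp_add]
    exact setLIntegral_cell_comp_add s (gradSqC f) a
  have h4 : volume (cell s \ Ω') = volume (cellShift s a \ Ω) := by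
    rw [cell_eq_preimage_cellShift s a, ← Set.preimage_sdiff]
    exact measure_preimage_add_right (volume : Measure Space) a _
  rw [h1, h2, h3, h4] at h
  exact h

end Translate

/-! ### Half-open cell sets of an assignment of cells to particles -/

section HalfOpen

variable {N K : ℕ} {s : ℝ}

/-- The open cell with index `c` lies in the half-open sub-cell with lattice coordinates
`cellCoord K c`. [folklore] -/
theorem mem_subCell_cellCoord_of_sub_mem_box {c : Fin (K ^ 3)} {x : Space}
    (hx : x - cellCorner K s c ∈ box s) : x ∈ subCell s (cellCoord K c) := by
  rw [mem_subCell]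
  intro i
  have h := hx i
  simp only [PiLp.sub_apply, cellCorner_apply, Set.mem_Ioo] at h
  constructor <;> linarith [h.1, h.2]

/-- The tree's (open) cell set of `σ` lies in the half-open cell set of `σ`. [folklore] -/
theorem cellSet_subset_hcellSet (K : ℕ) (s : ℝ) (σ : Fin N → Fin (K ^ 3)) :
    cellSet K s σ ⊆ {X : Config N | ∀ j, X j ∈ subCell s (cellCoord K (σ j))} :=
  fun _ hX j => mem_subCell_cellCoord_of_sub_mem_box (hX j)

/-- Half-open cell sets are measurable. [folklore] -/
theorem measurableSet_hcellSet (K : ℕ) (s : ℝ) (σ : Fin N → Fin (K ^ 3)) :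
    MeasurableSet {X : Config N | ∀ j, X j ∈ subCell s (cellCoord K (σ j))} := by
  have : {X : Config N | ∀ j, X j ∈ subCell s (cellCoord K (σ j))} =
      ⋂ j, (fun X : Config N => X j) ⁻¹' subCell s (cellCoord K (σ j)) := by
    ext X; simp
  rw [this]
  exact MeasurableSet.iInter fun j => (measurableSet_subCell s _).preimage (measurable_pi_apply j)

/-- Half-open cell sets lie in the fundamental cell `[0, Ks)^{3N}`. [folklore] -/
theorem hcellSet_subset_cellN (hs : 0 < s) (σ : Fin N → Fin (K ^ 3)) :
    {X : Config N | ∀ j, X j ∈ subCell s (cellCoord K (σ j))} ⊆ cellN N (K * s) :=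
  fun _ hX j => subCell_subset_cell hs _ (hX j)

/-- On a half-open cell set the sub-cell of every particle is determined by the assignment.
[folklore] -/
theorem mem_subCell_iff_of_mem_hcellSet (hs : 0 < s) {σ : Fin N → Fin (K ^ 3)} {X : Config N}
    (hX : X ∈ {X : Config N | ∀ j, X j ∈ subCell s (cellCoord K (σ j))}) (j : Fin N)
    (q : SubIdx K) : X j ∈ subCell s q ↔ cellCoord K (σ j) = q := by
  constructor
  · intro h
    by_contra hne
    exact not_mem_subCell_of_ne hs hne (hX j) h
  · rintro rfl; exact hX j

/-- Distinct assignments have disjoint half-open cell sets. [folklore] -/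
theorem pairwiseDisjoint_hcellSet (hs : 0 < s) :
    Pairwise (Function.onFun Disjoint fun σ : Fin N → Fin (K ^ 3) =>
      {X : Config N | ∀ j, X j ∈ subCell s (cellCoord K (σ j))}) := by
  intro σ σ' hne
  rw [Function.onFun, Set.disjoint_left]
  intro X hX hX'
  apply hne
  funext j
  apply finFunctionFinEquiv.symm.injective
  exact (mem_subCell_iff_of_mem_hcellSet hs hX j _).1 (hX' j)

/-- The half-open cell sets partition the fundamental cell exactly. [folklore] -/
theorem iUnion_hcellSet_eq_cellN (hs : 0 < s) :
    (⋃ σ : Fin N → Fin (K ^ 3), {X : Config N | ∀ j, X j ∈ subCell s (cellCoord K (σ j))}) =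
      cellN N (K * s) := by
  refine Set.Subset.antisymm (Set.iUnion_subset fun σ => hcellSet_subset_cellN hs σ) ?_
  intro X hX
  choose q hq using fun j => exists_mem_subCell (k := K) hs (hX j)
  refine Set.mem_iUnion.2 ⟨fun j => finFunctionFinEquiv (q j), fun j => ?_⟩
  have : cellCoord K (finFunctionFinEquiv (q j)) = q j := by
    simp [cellCoord]
  rw [this]; exact hq j

/-- The half-open and the open cell set of an assignment agree a.e. [folklore] -/
theorem hcellSet_ae_eq_cellSet (hs : 0 < s) (hK : 0 < K) (σ : Fin N → Fin (K ^ 3)) :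
    {X : Config N | ∀ j, X j ∈ subCell s (cellCoord K (σ j))} =ᵐ[volume] cellSet K s σ := by
  have hU : (⋃ τ : Fin N → Fin (K ^ 3), cellSet K s τ) =ᵐ[volume] cellN N (K * s) :=
    (boxN_ae_eq_iUnion_cellSet (N := N) hs hK).symm.trans (boxN_ae_eq_cellN N (K * s))
  rw [← iUnion_hcellSet_eq_cellN hs] at hU
  refine ae_eq_set.2 ⟨?_, ?_⟩
  · have h0 : volume ((⋃ τ : Fin N → Fin (K ^ 3),
        {X : Config N | ∀ j, X j ∈ subCell s (cellCoord K (τ j))}) \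
          ⋃ τ : Fin N → Fin (K ^ 3), cellSet K s τ) = 0 := (ae_eq_set.1 hU).2
    refine measure_mono_null (fun X hX => ?_) h0
    refine ⟨Set.mem_iUnion.2 ⟨σ, hX.1⟩, fun hmem => ?_⟩
    obtain ⟨τ, hτ⟩ := Set.mem_iUnion.1 hmem
    have hτ' := cellSet_subset_hcellSet K s τ hτ
    have : τ = σ := by
      by_contra hne
      exact Set.disjoint_left.1 (pairwiseDisjoint_hcellSet (N := N) hs hne) hτ' hX.1
    subst this
    exact hX.2 hτ
  · rw [Set.sdiff_eq_empty.2 (cellSet_subset_hcellSet K s σ)]; exact measure_empty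

/-- Consequently integrals over the two cell sets agree. [folklore] -/
theorem setLIntegral_hcellSet_eq_cellSet (hs : 0 < s) (hK : 0 < K) (σ : Fin N → Fin (K ^ 3))
    (F : Config N → ℝ≥0∞) :
    ∫⁻ X in {X : Config N | ∀ j, X j ∈ subCell s (cellCoord K (σ j))}, F X =
      ∫⁻ X in cellSet K s σ, F X :=
  setLIntegral_congr (hcellSet_ae_eq_cellSet hs hK σ)

end HalfOpen

/-! ### The sub-cell depletion identity `∑_q ⟨u_q, γ_Ψ u_q⟩ + depletion = N` -/

section Depletion

variable {N n K : ℕ} {s L : ℝ}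

/-- Bose symmetry moves the distinguished slot of a sub-cell slice mean to `0`. [folklore] -/
theorem subcellMeanSq_eq_zero_comp_swap (Q : Set Space) (i : Fin (n + 1))
    {Ψ : Config (n + 1) → ℂ}
    (hsymm : ∀ (σ : Equiv.Perm (Fin (n + 1))) (X : Config (n + 1)), Ψ (X ∘ σ) = Ψ X)
    (X : Config (n + 1)) :
    (‖∫ x in Q, Ψ (Function.update X i x)‖₊ : ℝ≥0∞) ^ 2 =
      (‖∫ x in Q, Ψ (Function.update (X ∘ Equiv.swap 0 i) 0 x)‖₊ : ℝ≥0∞) ^ 2 := by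
  have h : (fun x => Ψ (Function.update X i x)) =
      fun x => Ψ (Function.update (X ∘ Equiv.swap 0 i) 0 x) :=
    funext fun x => by rw [← hsymm (Equiv.swap 0 i) (Function.update X i x), update_comp_swap]
  rw [h]

/-- `∫_{Ω^{n+1}} |∫_Q Ψ(update X 0 x) dx|² dX = L³ ∫_{Ω^n} |∫_Q Ψ(x, Y) dx|² dY`. [folklore] -/
theorem lintegral_subcellMeanSq_zero (L : ℝ) (Q : Set Space) {Ψ : Config (n + 1) → ℂ}
    (hΨ : Continuous Ψ) :
    ∫⁻ X in cellN (n + 1) L, (‖∫ x in Q, Ψ (Function.update X 0 x)‖₊ : ℝ≥0∞) ^ 2 =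
      ENNReal.ofReal L ^ 3 *
        ∫⁻ Y in cellN n L, (‖∫ x in Q, Ψ (Matrix.vecCons x Y)‖₊ : ℝ≥0∞) ^ 2 := by
  set μ : Fin (n + 1) → Measure Space := fun _ => volume.restrict (cell L) with hμ
  have hmp := measurePreserving_piFinSuccAbove μ 0
  rw [volume_restrict_cellN, volume_restrict_cellN,
    hmp.symm.lintegral_map_equiv
      (fun X => (‖∫ x in Q, Ψ (Function.update X 0 x)‖₊ : ℝ≥0∞) ^ 2)]
  have hG : ∀ z : Space × Config n,
      (‖∫ x in Q, Ψ (Function.update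
          ((MeasurableEquiv.piFinSuccAbove (fun _ => Space) 0).symm z) 0 x)‖₊ : ℝ≥0∞) ^ 2 =
        (‖∫ x in Q, Ψ (Matrix.vecCons x z.2)‖₊ : ℝ≥0∞) ^ 2 := by
    rintro ⟨y, Y⟩
    have : (MeasurableEquiv.piFinSuccAbove (fun _ : Fin (n + 1) => Space) 0).symm (y, Y) =
        Matrix.vecCons y Y := by
      change Fin.insertNth 0 y Y = (Fin.cons y Y : Config (n + 1))
      exact Fin.insertNth_zero' y Y
    rw [this]
    simp only [Matrix.vecCons, Fin.update_cons_zero]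
  simp only [hG]
  have hmeas : Measurable fun Y : Config n =>
      (‖∫ x in Q, Ψ (Matrix.vecCons x Y)‖₊ : ℝ≥0∞) ^ 2 := measurable_sliceSetIntegral_sq hΨ Q
  rw [lintegral_prod (fun z : Space × Config n =>
      (‖∫ x in Q, Ψ (Matrix.vecCons x z.2)‖₊ : ℝ≥0∞) ^ 2) (hmeas.comp measurable_snd).aemeasurable]
  simp only
  rw [lintegral_const, Measure.restrict_apply_univ, volume_cell, mul_comm]

/-- Measurability of the sub-cell slice mean in the other variables. [folklore] -/
theorem measurable_subcellMeanSq (Q : Set Space) (i : Fin N) {Ψ : Config N → ℂ}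
    (hΨ : Continuous Ψ) :
    Measurable fun X => (‖∫ x in Q, Ψ (Function.update X i x)‖₊ : ℝ≥0∞) ^ 2 := by
  have h : StronglyMeasurable
      (Function.uncurry fun (X : Config N) (x : Space) => Ψ (Function.update X i x)) := by
    refine (hΨ.comp ?_).stronglyMeasurable
    exact continuous_fst.update i continuous_snd
  have h2 : StronglyMeasurable fun X : Config N => ∫ x in Q, Ψ (Function.update X i x) :=
    h.integral_prod_right' (ν := volume.restrict Q)
  exact (h2.measurable.nnnorm.coe_nnreal_ennreal).pow_const _

/-- **The sub-cell mean terms summed over the particles give the occupation of the sub-cell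
mode**: `∑ᵢ L⁻³ ∫_{Ω^N} s⁻³ |∫_{Q_q} Ψ(…, xᵢ = x, …) dx|² dX = ⟨u_q, γ_Ψ u_q⟩` for a Dirichlet state
of `Λ_L` (Bose symmetry; the Dirichlet state vanishes off the box). [folklore] -/
theorem sum_lintegral_subcellMeanSq (hs : 0 < s) (hL : 0 < L) (q : SubIdx K)
    (Ψ : TrialState (n + 1) L) :
    ∑ i : Fin (n + 1), (ENNReal.ofReal L ^ 3)⁻¹ *
        ∫⁻ X in cellN (n + 1) L, (ENNReal.ofReal s ^ 3)⁻¹ *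
          (‖∫ x in subCell s q, Ψ.ψ (Function.update X i x)‖₊ : ℝ≥0∞) ^ 2 =
      occupation (n + 1) (subMode s q) Ψ.ψ := by
  have hL3 : ENNReal.ofReal L ^ 3 ≠ 0 := pow_ne_zero _ (by simpa using hL)
  have hL3' : ENNReal.ofReal L ^ 3 ≠ ⊤ := ENNReal.pow_ne_top ENNReal.ofReal_ne_top
  have hs3' : (ENNReal.ofReal s ^ 3)⁻¹ ≠ ⊤ :=
    ENNReal.inv_ne_top.2 (pow_ne_zero _ (by simpa using hs))
  have hcont := Ψ.contDiff.continuous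
  have hterm : ∀ i : Fin (n + 1),
      (ENNReal.ofReal L ^ 3)⁻¹ *
          ∫⁻ X in cellN (n + 1) L, (ENNReal.ofReal s ^ 3)⁻¹ *
            (‖∫ x in subCell s q, Ψ.ψ (Function.update X i x)‖₊ : ℝ≥0∞) ^ 2 =
        (ENNReal.ofReal s ^ 3)⁻¹ *
          ∫⁻ Y in cellN n L, (‖∫ x in subCell s q, Ψ.ψ (Matrix.vecCons x Y)‖₊ : ℝ≥0∞) ^ 2 := by
    intro i
    rw [lintegral_const_mul' _ _ hs3']
    have h1 : (fun X => (‖∫ x in subCell s q, Ψ.ψ (Function.update X i x)‖₊ : ℝ≥0∞) ^ 2) =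
        fun X => (‖∫ x in subCell s q,
          Ψ.ψ (Function.update (X ∘ Equiv.swap 0 i) 0 x)‖₊ : ℝ≥0∞) ^ 2 :=
      funext fun X => subcellMeanSq_eq_zero_comp_swap _ i Ψ.symm X
    rw [h1, lintegral_cellN_comp_perm (Equiv.swap 0 i)
        (fun X => (‖∫ x in subCell s q, Ψ.ψ (Function.update X 0 x)‖₊ : ℝ≥0∞) ^ 2),
      lintegral_subcellMeanSq_zero L _ hcont, ← mul_assoc, ← mul_assoc,
      mul_comm (ENNReal.ofReal L ^ 3)⁻¹, mul_assoc _ _ (ENNReal.ofReal L ^ 3),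
      ENNReal.inv_mul_cancel hL3 hL3', mul_one]
  simp only [hterm, Finset.sum_const, Finset.card_univ, Fintype.card_fin, nsmul_eq_mul]
  rw [occupation_subMode hs q Ψ.ψ]
  have hsupp : Function.support (fun Y : Config n => (ENNReal.ofReal s ^ 3)⁻¹ *
      (‖∫ x in subCell s q, Ψ.ψ (Matrix.vecCons x Y)‖₊ : ℝ≥0∞) ^ 2) ⊆ cellN n L := by
    intro Y hY
    by_contra hYc
    have hzero : ∀ x, Ψ.ψ (Matrix.vecCons x Y) = 0 := fun x => Ψ.eq_zero _ fun hbox => hYc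
      fun j k => Set.Ioo_subset_Ico_self ((by simpa using hbox j.succ : Y j ∈ box L) k)
    exact hY (by simp [hzero])
  rw [← setLIntegral_eq_of_support_subset hsupp, lintegral_const_mul' _ _ hs3']
  push_cast
  ring

/-- **The sub-cell depletion identity** (LSSY (5.17) per sub-cell, symmetrised): for a Dirichlet
state `Ψ` of `Λ_L`, `L = Ks`,
`∑_q ⟨u_q, γ_Ψ u_q⟩ + ∑ᵢ L⁻³ ∫_{Ω^N} ∑_q ∫_{Q_q} |Ψ(…,xᵢ = x,…) - ⟨Ψ(…,xᵢ = ·,…)⟩_{Q_q}|² dx dX = N`.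
[folklore] -/
theorem occupation_add_depletion_eq (hs : 0 < s) (hL : 0 < L) (hKs : (K : ℝ) * s = L)
    (Ψ : TrialState (n + 1) L) :
    (∑ q : SubIdx K, occupation (n + 1) (subMode s q) Ψ.ψ) +
      ∑ i : Fin (n + 1), (ENNReal.ofReal L ^ 3)⁻¹ * ∫⁻ X in cellN (n + 1) L,
        ∑ q : SubIdx K, ∫⁻ x in subCell s q,
          (‖Ψ.ψ (Function.update X i x) -
            ⨍ y in subCell s q, Ψ.ψ (Function.update X i y)‖₊ : ℝ≥0∞) ^ 2 =
      ((n + 1 : ℕ) : ℝ≥0∞) := by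
  have hL3 : ENNReal.ofReal L ^ 3 ≠ 0 := pow_ne_zero _ (by simpa using hL)
  have hL3' : ENNReal.ofReal L ^ 3 ≠ ⊤ := ENNReal.pow_ne_top ENNReal.ofReal_ne_top
  have hcont : Continuous Ψ.ψ := Ψ.contDiff.continuous
  have hnorm : ∫⁻ X in cellN (n + 1) L, (‖Ψ.ψ X‖₊ : ℝ≥0∞) ^ 2 = 1 := by
    rw [setLIntegral_eq_of_support_subset]
    · exact Ψ.norm_eq
    · intro X hX
      by_contra h
      have hb : X ∉ boxN (n + 1) L := fun hb => h fun i k => Set.Ioo_subset_Ico_self (hb i k)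
      exact hX (by simp [Ψ.eq_zero X hb])
  have hone : ∀ i : Fin (n + 1), (ENNReal.ofReal L ^ 3)⁻¹ *
      ∫⁻ X in cellN (n + 1) L, ∫⁻ x in cell L,
        (‖Ψ.ψ (Function.update X i x)‖₊ : ℝ≥0∞) ^ 2 = 1 := by
    intro i
    rw [lintegral_normSq_slice i hcont.measurable, hnorm, mul_one,
      ENNReal.inv_mul_cancel hL3 hL3']
  have hsplit : ∀ (i : Fin (n + 1)) (X : Config (n + 1)),
      ∫⁻ x in cell L, (‖Ψ.ψ (Function.update X i x)‖₊ : ℝ≥0∞) ^ 2 =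
        (∑ q : SubIdx K, ∫⁻ x in subCell s q,
          (‖Ψ.ψ (Function.update X i x) -
            ⨍ y in subCell s q, Ψ.ψ (Function.update X i y)‖₊ : ℝ≥0∞) ^ 2) +
        ∑ q : SubIdx K, (ENNReal.ofReal s ^ 3)⁻¹ *
          (‖∫ x in subCell s q, Ψ.ψ (Function.update X i x)‖₊ : ℝ≥0∞) ^ 2 := by
    intro i X
    have hc : Continuous fun x => Ψ.ψ (Function.update X i x) :=
      hcont.comp (continuous_const.update i continuous_id)
    have hpart := sum_setLIntegral_subCell (k := K) hs
      (hc.measurable.nnnorm.coe_nnreal_ennreal.pow_const 2).aemeasurable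
    rw [hKs] at hpart
    rw [← hpart, ← Finset.sum_add_distrib]
    refine Finset.sum_congr rfl fun q _ => ?_
    exact lintegral_nnnorm_sq_cellShift_eq hs hc (subOffset s q)
  have hN : ((n + 1 : ℕ) : ℝ≥0∞) = ∑ i : Fin (n + 1), (ENNReal.ofReal L ^ 3)⁻¹ *
      ∫⁻ X in cellN (n + 1) L, ∫⁻ x in cell L,
        (‖Ψ.ψ (Function.update X i x)‖₊ : ℝ≥0∞) ^ 2 := by
    simp only [hone, Finset.sum_const, Finset.card_univ, Fintype.card_fin, nsmul_eq_mul,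
      mul_one]
  have hmeas : ∀ i : Fin (n + 1), Measurable fun X : Config (n + 1) =>
      ∑ q : SubIdx K, (ENNReal.ofReal s ^ 3)⁻¹ *
        (‖∫ x in subCell s q, Ψ.ψ (Function.update X i x)‖₊ : ℝ≥0∞) ^ 2 := fun i =>
    Finset.measurable_sum _ fun q _ => (measurable_subcellMeanSq _ i hcont).const_mul _
  have hocc : ∑ i : Fin (n + 1), (ENNReal.ofReal L ^ 3)⁻¹ * ∫⁻ X in cellN (n + 1) L,
      ∑ q : SubIdx K, (ENNReal.ofReal s ^ 3)⁻¹ *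
        (‖∫ x in subCell s q, Ψ.ψ (Function.update X i x)‖₊ : ℝ≥0∞) ^ 2 =
      ∑ q : SubIdx K, occupation (n + 1) (subMode s q) Ψ.ψ := by
    have : ∀ i : Fin (n + 1), (ENNReal.ofReal L ^ 3)⁻¹ * ∫⁻ X in cellN (n + 1) L,
        ∑ q : SubIdx K, (ENNReal.ofReal s ^ 3)⁻¹ *
          (‖∫ x in subCell s q, Ψ.ψ (Function.update X i x)‖₊ : ℝ≥0∞) ^ 2 =
        ∑ q : SubIdx K, (ENNReal.ofReal L ^ 3)⁻¹ * ∫⁻ X in cellN (n + 1) L,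
          (ENNReal.ofReal s ^ 3)⁻¹ *
            (‖∫ x in subCell s q, Ψ.ψ (Function.update X i x)‖₊ : ℝ≥0∞) ^ 2 := by
      intro i
      rw [lintegral_finsetSum _ fun q _ => (measurable_subcellMeanSq _ i hcont).const_mul _,
        Finset.mul_sum]
    simp only [this]
    rw [Finset.sum_comm]
    exact Finset.sum_congr rfl fun q _ => sum_lintegral_subcellMeanSq hs hL q Ψ
  rw [hN, ← hocc, add_comm, ← Finset.sum_add_distrib]
  refine Finset.sum_congr rfl fun i _ => ?_
  rw [← mul_add, ← lintegral_add_right' _ (hmeas i).aemeasurable]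
  congr 1
  refine lintegral_congr fun X => ?_
  rw [hsplit i X]

end Depletion


/-! ## Part B: the slice bound (Lemma 4.1 per sub-cell, summed and integrated) -/

section SliceBound

variable {N K : ℕ} {s L : ℝ}

/-- The variance is at most the second moment: `∫_Q |f - ⟨f⟩_Q|² ≤ ∫_Q |f|²`. [folklore] -/
theorem lintegral_var_cellShift_le (hs : 0 < s) {φ : Space → ℂ} (hφ : Continuous φ) (a : Space) :
    ∫⁻ x in cellShift s a, (‖φ x - ⨍ y in cellShift s a, φ y‖₊ : ℝ≥0∞) ^ 2 ≤
      ∫⁻ x in cellShift s a, (‖φ x‖₊ : ℝ≥0∞) ^ 2 := by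
  rw [lintegral_nnnorm_sq_cellShift_eq hs hφ a]; exact le_self_add

/-- Moving one particle into the sub-cell `q` moves the configuration into the half-open cell set
of the updated assignment. [folklore] -/
theorem update_mem_hcellSet {σ : Fin N → Fin (K ^ 3)} {X : Config N}
    (hX : X ∈ {X : Config N | ∀ j, X j ∈ subCell s (cellCoord K (σ j))}) (i : Fin N)
    {q : SubIdx K} {x : Space} (hx : x ∈ subCell s q) :
    Function.update X i x ∈ {X : Config N | ∀ j, X j ∈ subCell s
      (cellCoord K (Function.update σ i (finFunctionFinEquiv q) j))} := by
  intro j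
  by_cases hj : j = i
  · subst hj
    simpa [cellCoord] using hx
  · simp only [Function.update_of_ne hj]
    exact hX j

/-- On the half-open cell set of `σ`, a sum of cell-set indicators collapses to the `σ` term.
[folklore] -/
theorem sum_indicator_hcellSet_eq (hs : 0 < s) {σ : Fin N → Fin (K ^ 3)} {Y : Config N}
    (hY : Y ∈ {X : Config N | ∀ j, X j ∈ subCell s (cellCoord K (σ j))})
    (G : (Fin N → Fin (K ^ 3)) → Config N → ℝ≥0∞) :
    ∑ τ : Fin N → Fin (K ^ 3),
        {X : Config N | ∀ j, X j ∈ subCell s (cellCoord K (τ j))}.indicator (G τ) Y = G σ Y := by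
  rw [Finset.sum_eq_single σ]
  · exact Set.indicator_of_mem hY _
  · intro τ _ hτ
    refine Set.indicator_of_notMem (fun hYτ => ?_) _
    exact Set.disjoint_left.1 (pairwiseDisjoint_hcellSet (N := N) hs hτ) hYτ hY
  · intro h; exact absurd (Finset.mem_univ σ) h

/-- The occupation number of the cell of the moved particle: if particle `i` is re-assigned to
cell `c`, the cell `c` holds the other particles of `c` plus one. [folklore] -/
theorem card_filter_update_eq (σ : Fin N → Fin (K ^ 3)) (i : Fin N) (c : Fin (K ^ 3)) :
    (Finset.univ.filter fun j => Function.update σ i c j = c).card =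
      ((Finset.univ.erase i).filter fun j => σ j = c).card + 1 := by
  have : (Finset.univ.filter fun j => Function.update σ i c j = c) =
      insert i ((Finset.univ.erase i).filter fun j => σ j = c) := by
    ext j
    by_cases hj : j = i
    · subst hj; simp
    · simp [hj]
  rw [this, Finset.card_insert_of_notMem (by simp)]

/-- The same-cell far region of the moved particle is measurable. [folklore] -/
theorem measurableSet_farSlice (σ : Fin N → Fin (K ^ 3)) (i : Fin N) (c : Fin (K ^ 3)) (R : ℝ)
    (X : Config N) :
    MeasurableSet {x : Space | ∀ j, j ≠ i → σ j = c → R ≤ dist x (X j)} := by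
  have : {x : Space | ∀ j, j ≠ i → σ j = c → R ≤ dist x (X j)} =
      ⋂ j ∈ (Finset.univ.erase i).filter (fun j => σ j = c), {x : Space | R ≤ dist x (X j)} := by
    ext x
    simp only [Set.mem_setOf_eq, Finset.mem_filter, Finset.mem_erase, Finset.mem_univ, and_true,
      Set.mem_iInter, and_imp]
  rw [this]
  exact Finset.measurableSet_biInter _ fun j _ =>
    measurableSet_le measurable_const (continuous_id.dist continuous_const).measurable

/-- The same-cell far region in configuration space is measurable. [folklore] -/
theorem measurableSet_farConfig (σ : Fin N → Fin (K ^ 3)) (i : Fin N) (R : ℝ) :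
    MeasurableSet {Y : Config N | ∀ j, j ≠ i → σ j = σ i → R ≤ dist (Y i) (Y j)} := by
  have : {Y : Config N | ∀ j, j ≠ i → σ j = σ i → R ≤ dist (Y i) (Y j)} =
      ⋂ j ∈ (Finset.univ.erase i).filter (fun j => σ j = σ i),
        {Y : Config N | R ≤ dist (Y i) (Y j)} := by
    ext Y
    simp only [Set.mem_setOf_eq, Finset.mem_filter, Finset.mem_erase, Finset.mem_univ, and_true,
      Set.mem_iInter, and_imp]
  rw [this]
  exact Finset.measurableSet_biInter _ fun j _ =>
    measurableSet_le measurable_const ((measurable_pi_apply i).dist (measurable_pi_apply j))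

/-- The excluded volume of the same-cell far region: at most the number of other particles in the
cell times the volume of a ball of radius `R`. [folklore] -/
theorem volume_diff_farSlice_le (σ : Fin N → Fin (K ^ 3)) (i : Fin N) (c : Fin (K ^ 3)) (R : ℝ)
    (X : Config N) (Q : Set Space) :
    volume (Q \ {x : Space | ∀ j, j ≠ i → σ j = c → R ≤ dist x (X j)}) ≤
      (((Finset.univ.erase i).filter fun j => σ j = c).card : ℝ≥0∞) *
        (ENNReal.ofReal R ^ 3 * ENNReal.ofReal (Real.pi * 4 / 3)) := by
  set T := (Finset.univ.erase i).filter fun j => σ j = c with hT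
  calc volume (Q \ {x : Space | ∀ j, j ≠ i → σ j = c → R ≤ dist x (X j)})
      ≤ volume (⋃ j ∈ T, ball (X j) R) := by
        refine measure_mono fun x hx => ?_
        have hx2 := hx.2
        simp only [Set.mem_setOf_eq, not_forall, not_le, exists_prop] at hx2
        obtain ⟨j, hj, hc, hlt⟩ := hx2
        refine Set.mem_biUnion (x := j) ?_ ?_
        · simp [hT, hj, hc]
        · rw [mem_ball]; exact hlt
    _ ≤ ∑ j ∈ T, volume (ball (X j) R) := measure_biUnion_finset_le _ _
    _ = (T.card : ℝ≥0∞) * (ENNReal.ofReal R ^ 3 * ENNReal.ofReal (Real.pi * 4 / 3)) := by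
        simp only [EuclideanSpace.volume_ball_fin_three, Finset.sum_const, nsmul_eq_mul]

/-- **Lemma 4.1 on one sub-cell of one slice** (the case split of the floor proof). Let `X` lie
in the half-open cell set of `σ₀`, fix a particle `i` and a sub-cell `q`, and let `m` be the
number of OTHER particles of `X` in `q`.  If `m + 1` is `good`, the generalized Poincaré
inequality on `q` with the balls of radius `R(m+1)` about those particles removed bounds the
slice variance by `C (s² ∫_q 1_far |∇ᵢΨ|² + w ∫_q |∇ᵢΨ|²)`; otherwise the variance is at most
`∫_q |Ψ|²`.  Both bounds are dominated by the integral over `q` of the bookkeeping density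
`C (s² H^out + w H^kin) + H^bad` evaluated on the moved configuration. [folklore] -/
theorem slice_subcell_bound (hs : 0 < s) {ψ : Config N → ℂ} (hψ : ContDiff ℝ 1 ψ)
    (good : ℕ → Prop) [DecidablePred good] (Rf : ℕ → ℝ) {C w : ℝ}
    (h41 : ∀ (L : ℝ), 0 < L → ∀ (f : Space → ℂ), ContDiff ℝ 1 f →
      ∀ (Ω : Set Space), MeasurableSet Ω → Ω ⊆ cell L →
        ∫⁻ x in cell L, (‖f x - ⨍ y in cell L, f y‖₊ : ℝ≥0∞) ^ 2 ≤
          ENNReal.ofReal C *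
            (ENNReal.ofReal (L ^ 2) * (∫⁻ x in Ω, gradSqC f x) +
              volume (cell L \ Ω) ^ (2 / 3 : ℝ) * ∫⁻ x in cell L, gradSqC f x))
    (hW : ∀ m : ℕ, good (m + 1) →
      ((m : ℝ≥0∞) * (ENNReal.ofReal (Rf (m + 1)) ^ 3 * ENNReal.ofReal (Real.pi * 4 / 3))) ^
        (2 / 3 : ℝ) ≤ ENNReal.ofReal w)
    (Hout Hkin Hbad : Fin N → Config N → ℝ≥0∞) (hmo : ∀ i, Measurable (Hout i))
    (hmk : ∀ i, Measurable (Hkin i))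
    (hHout : ∀ (σ : Fin N → Fin (K ^ 3)) (i : Fin N) (Y : Config N),
      Y ∈ {X : Config N | ∀ j, X j ∈ subCell s (cellCoord K (σ j))} →
      good (Finset.univ.filter fun j => σ j = σ i).card →
        Hout i Y = {Y : Config N | ∀ j, j ≠ i → σ j = σ i →
          Rf (Finset.univ.filter fun j => σ j = σ i).card ≤ dist (Y i) (Y j)}.indicator
            (partialGradSq i ψ) Y)
    (hHkin : ∀ (σ : Fin N → Fin (K ^ 3)) (i : Fin N) (Y : Config N),
      Y ∈ {X : Config N | ∀ j, X j ∈ subCell s (cellCoord K (σ j))} →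
      good (Finset.univ.filter fun j => σ j = σ i).card → Hkin i Y = partialGradSq i ψ Y)
    (hHbad : ∀ (σ : Fin N → Fin (K ^ 3)) (i : Fin N) (Y : Config N),
      Y ∈ {X : Config N | ∀ j, X j ∈ subCell s (cellCoord K (σ j))} →
      ¬ good (Finset.univ.filter fun j => σ j = σ i).card →
        Hbad i Y = (‖ψ Y‖₊ : ℝ≥0∞) ^ 2)
    {σ₀ : Fin N → Fin (K ^ 3)} {X : Config N}
    (hX : X ∈ {X : Config N | ∀ j, X j ∈ subCell s (cellCoord K (σ₀ j))}) (i : Fin N)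
    (q : SubIdx K) :
    ∫⁻ x in subCell s q, (‖ψ (Function.update X i x) -
        ⨍ y in subCell s q, ψ (Function.update X i y)‖₊ : ℝ≥0∞) ^ 2 ≤
      ∫⁻ x in subCell s q, (ENNReal.ofReal C * (ENNReal.ofReal (s ^ 2) *
        Hout i (Function.update X i x) + ENNReal.ofReal w * Hkin i (Function.update X i x)) +
          Hbad i (Function.update X i x)) := by
  set c : Fin (K ^ 3) := finFunctionFinEquiv q with hc
  set σ : Fin N → Fin (K ^ 3) := Function.update σ₀ i c with hσ
  set m : ℕ := ((Finset.univ.erase i).filter fun j => σ₀ j = c).card with hm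
  have hσi : σ i = c := by simp [hσ]
  have hσj : ∀ j, j ≠ i → σ j = σ₀ j := fun j hj => by simp [hσ, hj]
  have hn : (Finset.univ.filter fun j => σ j = σ i).card = m + 1 := by
    rw [hσi]; exact card_filter_update_eq σ₀ i c
  have hmem : ∀ x ∈ subCell s q, Function.update X i x ∈
      {X : Config N | ∀ j, X j ∈ subCell s (cellCoord K (σ j))} := fun x hx =>
    update_mem_hcellSet hX i hx
  set f : Space → ℂ := fun x => ψ (Function.update X i x) with hf_def
  have hf : ContDiff ℝ 1 f := hψ.comp (contDiff_update 1 X i)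
  have hdiff : Differentiable ℝ ψ := hψ.differentiable one_ne_zero
  have hgrad : ∀ x, gradSqC f x = partialGradSq i ψ (Function.update X i x) := fun x =>
    gradSqC_slice hdiff X i x
  have hmu : Measurable (Function.update X i : Space → Config N) := measurable_update X
  -- the right-hand side, split
  have hRHS : ∫⁻ x in subCell s q, (ENNReal.ofReal C * (ENNReal.ofReal (s ^ 2) *
        Hout i (Function.update X i x) + ENNReal.ofReal w * Hkin i (Function.update X i x)) +
          Hbad i (Function.update X i x)) =
      ENNReal.ofReal C * (ENNReal.ofReal (s ^ 2) *
        (∫⁻ x in subCell s q, Hout i (Function.update X i x)) +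
          ENNReal.ofReal w * ∫⁻ x in subCell s q, Hkin i (Function.update X i x)) +
        ∫⁻ x in subCell s q, Hbad i (Function.update X i x) := by
    have hm1 : Measurable fun x => ENNReal.ofReal (s ^ 2) * Hout i (Function.update X i x) :=
      ((hmo i).comp hmu).const_mul _
    have hm2 : Measurable fun x => ENNReal.ofReal w * Hkin i (Function.update X i x) :=
      ((hmk i).comp hmu).const_mul _
    have hm12 : Measurable fun x => ENNReal.ofReal (s ^ 2) * Hout i (Function.update X i x) +
        ENNReal.ofReal w * Hkin i (Function.update X i x) := hm1.add hm2
    have hmA : Measurable fun x => ENNReal.ofReal C * (ENNReal.ofReal (s ^ 2) *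
        Hout i (Function.update X i x) + ENNReal.ofReal w * Hkin i (Function.update X i x)) :=
      hm12.const_mul _
    rw [lintegral_add_left hmA, lintegral_const_mul' _ _ ENNReal.ofReal_ne_top,
      lintegral_add_left hm1, lintegral_const_mul' _ _ ENNReal.ofReal_ne_top,
      lintegral_const_mul' _ _ ENNReal.ofReal_ne_top]
  rw [hRHS]
  by_cases hg : good (m + 1)
  · -- Lemma 4.1 with the same-cell balls removed
    set Far : Set Space := {x : Space | ∀ j, j ≠ i → σ₀ j = c → Rf (m + 1) ≤ dist x (X j)}
      with hFar
    have hFarm : MeasurableSet Far := measurableSet_farSlice σ₀ i c (Rf (m + 1)) X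
    have h41' := lemma41_cellShift h41 hs hf (subOffset s q) (Ω := subCell s q ∩ Far)
      ((measurableSet_subCell s q).inter hFarm) Set.inter_subset_left
    -- (a) the far part of the gradient is `H^out`
    have ha : ∫⁻ x in subCell s q ∩ Far, gradSqC f x =
        ∫⁻ x in subCell s q, Hout i (Function.update X i x) := by
      rw [Set.inter_comm, ← Measure.restrict_restrict hFarm, ← lintegral_indicator hFarm]
      refine setLIntegral_congr_fun (measurableSet_subCell s q) fun x hx => ?_
      rw [hHout σ i _ (hmem x hx) (hn ▸ hg), hn]
      have hiff : x ∈ Far ↔ Function.update X i x ∈ {Y : Config N | ∀ j, j ≠ i → σ j = σ i →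
          Rf (m + 1) ≤ dist (Y i) (Y j)} := by
        simp only [hFar, Set.mem_setOf_eq, Function.update_self, hσi]
        refine forall_congr' fun j => ⟨fun h hj hcj => ?_, fun h hj hcj => ?_⟩
        · rw [Function.update_of_ne hj]; exact h hj ((hσj j hj) ▸ hcj)
        · have := h hj ((hσj j hj).symm ▸ hcj); rwa [Function.update_of_ne hj] at this
      by_cases hxF : x ∈ Far
      · rw [Set.indicator_of_mem hxF, Set.indicator_of_mem (hiff.1 hxF), hgrad]
      · rw [Set.indicator_of_notMem hxF, Set.indicator_of_notMem (fun h => hxF (hiff.2 h))]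
    -- (b) the excluded volume
    have hb : volume (cellShift s (subOffset s q) \ (subCell s q ∩ Far)) ^ (2 / 3 : ℝ) ≤
        ENNReal.ofReal w := by
      refine le_trans (ENNReal.rpow_le_rpow ?_ (by norm_num)) (hW m hg)
      change volume (subCell s q \ (subCell s q ∩ Far)) ≤ _
      rw [Set.sdiff_self_inter]
      exact volume_diff_farSlice_le σ₀ i c (Rf (m + 1)) X (subCell s q)
    -- (c) the full gradient is `H^kin`
    have hcg : ∫⁻ x in cellShift s (subOffset s q), gradSqC f x =
        ∫⁻ x in subCell s q, Hkin i (Function.update X i x) := by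
      refine setLIntegral_congr_fun (measurableSet_subCell s q) fun x hx => ?_
      rw [hHkin σ i _ (hmem x hx) (hn ▸ hg), hgrad]
    calc _ ≤ _ := h41'
      _ ≤ ENNReal.ofReal C * (ENNReal.ofReal (s ^ 2) *
            (∫⁻ x in subCell s q, Hout i (Function.update X i x)) +
            ENNReal.ofReal w * ∫⁻ x in subCell s q, Hkin i (Function.update X i x)) := by
          rw [ha, hcg]; gcongr
      _ ≤ _ := le_self_add
  · -- the trivial bound
    calc _ ≤ ∫⁻ x in subCell s q, (‖f x‖₊ : ℝ≥0∞) ^ 2 :=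
          lintegral_var_cellShift_le hs hf.continuous (subOffset s q)
      _ = ∫⁻ x in subCell s q, Hbad i (Function.update X i x) := by
          refine setLIntegral_congr_fun (measurableSet_subCell s q) fun x hx => ?_
          rw [hHbad σ i _ (hmem x hx) (hn ▸ hg)]
      _ ≤ _ := le_add_self

/-- **The slice bound, summed over sub-cells and particles and integrated.** With bookkeeping
densities `H^out, H^kin, H^bad` as in `slice_subcell_bound`, the level-`s` depletion of `ψ` on
`[0,Ks)^{3N}` is at most `∑ᵢ ∫ (C (s² Hᵢ^out + w Hᵢ^kin) + Hᵢ^bad)` (the redundant slice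
variable integrates out, `lintegral_cellN_lintegral_update`). [folklore] -/
theorem depletion_le_sum_lintegral (hs : 0 < s) (hK : 0 < K) {ψ : Config N → ℂ}
    (hψ : ContDiff ℝ 1 ψ) (good : ℕ → Prop) [DecidablePred good] (Rf : ℕ → ℝ) {C w : ℝ}
    (h41 : ∀ (L : ℝ), 0 < L → ∀ (f : Space → ℂ), ContDiff ℝ 1 f →
      ∀ (Ω : Set Space), MeasurableSet Ω → Ω ⊆ cell L →
        ∫⁻ x in cell L, (‖f x - ⨍ y in cell L, f y‖₊ : ℝ≥0∞) ^ 2 ≤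
          ENNReal.ofReal C *
            (ENNReal.ofReal (L ^ 2) * (∫⁻ x in Ω, gradSqC f x) +
              volume (cell L \ Ω) ^ (2 / 3 : ℝ) * ∫⁻ x in cell L, gradSqC f x))
    (hW : ∀ m : ℕ, good (m + 1) →
      ((m : ℝ≥0∞) * (ENNReal.ofReal (Rf (m + 1)) ^ 3 * ENNReal.ofReal (Real.pi * 4 / 3))) ^
        (2 / 3 : ℝ) ≤ ENNReal.ofReal w)
    (Hout Hkin Hbad : Fin N → Config N → ℝ≥0∞) (hmo : ∀ i, Measurable (Hout i))
    (hmk : ∀ i, Measurable (Hkin i)) (hmb : ∀ i, Measurable (Hbad i))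
    (hHout : ∀ (σ : Fin N → Fin (K ^ 3)) (i : Fin N) (Y : Config N),
      Y ∈ {X : Config N | ∀ j, X j ∈ subCell s (cellCoord K (σ j))} →
      good (Finset.univ.filter fun j => σ j = σ i).card →
        Hout i Y = {Y : Config N | ∀ j, j ≠ i → σ j = σ i →
          Rf (Finset.univ.filter fun j => σ j = σ i).card ≤ dist (Y i) (Y j)}.indicator
            (partialGradSq i ψ) Y)
    (hHkin : ∀ (σ : Fin N → Fin (K ^ 3)) (i : Fin N) (Y : Config N),
      Y ∈ {X : Config N | ∀ j, X j ∈ subCell s (cellCoord K (σ j))} →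
      good (Finset.univ.filter fun j => σ j = σ i).card → Hkin i Y = partialGradSq i ψ Y)
    (hHbad : ∀ (σ : Fin N → Fin (K ^ 3)) (i : Fin N) (Y : Config N),
      Y ∈ {X : Config N | ∀ j, X j ∈ subCell s (cellCoord K (σ j))} →
      ¬ good (Finset.univ.filter fun j => σ j = σ i).card →
        Hbad i Y = (‖ψ Y‖₊ : ℝ≥0∞) ^ 2) :
    ∑ i : Fin N, (ENNReal.ofReal ((K : ℝ) * s) ^ 3)⁻¹ * ∫⁻ X in cellN N ((K : ℝ) * s),
        ∑ q : SubIdx K, ∫⁻ x in subCell s q,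
          (‖ψ (Function.update X i x) -
            ⨍ y in subCell s q, ψ (Function.update X i y)‖₊ : ℝ≥0∞) ^ 2 ≤
      ∑ i : Fin N, ∫⁻ X in cellN N ((K : ℝ) * s), (ENNReal.ofReal C * (ENNReal.ofReal (s ^ 2) *
        Hout i X + ENNReal.ofReal w * Hkin i X) + Hbad i X) := by
  have hL : 0 < (K : ℝ) * s := mul_pos (Nat.cast_pos.2 hK) hs
  have hL3 : ENNReal.ofReal ((K : ℝ) * s) ^ 3 ≠ 0 := pow_ne_zero _ (ENNReal.ofReal_pos.2 hL).ne'
  have hL3' : ENNReal.ofReal ((K : ℝ) * s) ^ 3 ≠ ⊤ := ENNReal.pow_ne_top ENNReal.ofReal_ne_top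
  refine Finset.sum_le_sum fun i _ => ?_
  have hKt : Measurable fun X => ENNReal.ofReal C * (ENNReal.ofReal (s ^ 2) * Hout i X +
      ENNReal.ofReal w * Hkin i X) + Hbad i X :=
    ((((hmo i).const_mul _).add ((hmk i).const_mul _)).const_mul _).add (hmb i)
  have hpt : ∀ X ∈ cellN N ((K : ℝ) * s),
      ∑ q : SubIdx K, ∫⁻ x in subCell s q, (‖ψ (Function.update X i x) -
          ⨍ y in subCell s q, ψ (Function.update X i y)‖₊ : ℝ≥0∞) ^ 2 ≤
        ∫⁻ x in cell ((K : ℝ) * s), (ENNReal.ofReal C * (ENNReal.ofReal (s ^ 2) *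
          Hout i (Function.update X i x) + ENNReal.ofReal w * Hkin i (Function.update X i x)) +
            Hbad i (Function.update X i x)) := by
    intro X hX
    rw [← iUnion_hcellSet_eq_cellN hs] at hX
    obtain ⟨σ₀, hσ₀⟩ := Set.mem_iUnion.1 hX
    have hmeas : AEMeasurable (fun x : Space => ENNReal.ofReal C * (ENNReal.ofReal (s ^ 2) *
        Hout i (Function.update X i x) + ENNReal.ofReal w * Hkin i (Function.update X i x)) +
          Hbad i (Function.update X i x)) volume :=
      (hKt.comp (measurable_update X)).aemeasurable
    rw [← sum_setLIntegral_subCell hs hmeas]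
    exact Finset.sum_le_sum fun q _ => slice_subcell_bound hs hψ good Rf h41 hW Hout Hkin Hbad
      hmo hmk hHout hHkin hHbad hσ₀ i q
  calc (ENNReal.ofReal ((K : ℝ) * s) ^ 3)⁻¹ * ∫⁻ X in cellN N ((K : ℝ) * s),
        ∑ q : SubIdx K, ∫⁻ x in subCell s q, (‖ψ (Function.update X i x) -
            ⨍ y in subCell s q, ψ (Function.update X i y)‖₊ : ℝ≥0∞) ^ 2
      ≤ (ENNReal.ofReal ((K : ℝ) * s) ^ 3)⁻¹ * ∫⁻ X in cellN N ((K : ℝ) * s),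
          ∫⁻ x in cell ((K : ℝ) * s), (ENNReal.ofReal C * (ENNReal.ofReal (s ^ 2) *
            Hout i (Function.update X i x) + ENNReal.ofReal w * Hkin i (Function.update X i x)) +
              Hbad i (Function.update X i x)) :=
        mul_le_mul_right (setLIntegral_mono' (measurableSet_cellN N _) hpt) _
    _ = _ := by
        rw [lintegral_cellN_lintegral_update i hKt, ← mul_assoc, ENNReal.inv_mul_cancel hL3 hL3',
          one_mul]

/-- Re-summation: particle sums of cell-set indicators become cell-set integrals of particle sums
(over the tree's open cell sets, which agree a.e. with the half-open ones). [folklore] -/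
theorem sum_lintegral_sum_indicator_hcellSet (hs : 0 < s) (hK : 0 < K)
    (G : (Fin N → Fin (K ^ 3)) → Fin N → Config N → ℝ≥0∞) (hG : ∀ σ i, Measurable (G σ i)) :
    ∑ i : Fin N, ∫⁻ X in cellN N ((K : ℝ) * s), ∑ σ : Fin N → Fin (K ^ 3),
        {X : Config N | ∀ j, X j ∈ subCell s (cellCoord K (σ j))}.indicator (G σ i) X =
      ∑ σ : Fin N → Fin (K ^ 3), ∫⁻ X in cellSet K s σ, ∑ i : Fin N, G σ i X := by
  have h1 : ∀ (i : Fin N) (σ : Fin N → Fin (K ^ 3)), ∫⁻ X in cellN N ((K : ℝ) * s),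
      {X : Config N | ∀ j, X j ∈ subCell s (cellCoord K (σ j))}.indicator (G σ i) X =
        ∫⁻ X in cellSet K s σ, G σ i X := by
    intro i σ
    rw [setLIntegral_indicator (measurableSet_hcellSet K s σ),
      Set.inter_eq_left.2 (hcellSet_subset_cellN hs σ), setLIntegral_hcellSet_eq_cellSet hs hK]
  calc _ = ∑ i : Fin N, ∑ σ : Fin N → Fin (K ^ 3), ∫⁻ X in cellSet K s σ, G σ i X := by
        refine Finset.sum_congr rfl fun i _ => ?_
        rw [lintegral_finsetSum _ fun σ _ => (hG σ i).indicator (measurableSet_hcellSet K s σ)]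
        exact Finset.sum_congr rfl fun σ _ => h1 i σ
    _ = _ := by
        rw [Finset.sum_comm]
        refine Finset.sum_congr rfl fun σ _ => ?_
        rw [lintegral_finsetSum _ fun i _ => hG σ i]

/-- Measurability of a function switched on or off by a proposition. [folklore] -/
theorem measurable_ite_const {α : Type*} [MeasurableSpace α] (p : Prop) [Decidable p]
    {f g : α → ℝ≥0∞} (hf : Measurable f) (hg : Measurable g) :
    Measurable fun x => if p then f x else g x := by
  by_cases hp : p
  · simp only [hp, if_true]; exact hf
  · simp only [hp, if_false]; exact hg

/-- **The slice bound in cell-set form.**  For every `C¹` `N`-body function `ψ`, every cell side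
`s` with `K` cells per axis, every classification `good` of occupation numbers with encounter
radii `R(n)` and an excluded-volume bound `w`, the level-`s` depletion of `ψ` is at most
`C (s² 𝒯^out + w 𝒦) + 𝒩^bad`, where, cell set by cell set, `𝒯^out` collects the kinetic
energy of the particles of good cells at distance `≥ R` from the other particles of their cell,
`𝒦` the kinetic energy of the particles of good cells, and `𝒩^bad` the mass-weighted number of
particles in cells that are not good (LSSY's (5.15) run sub-cell by sub-cell with a
configuration-dependent excluded volume). [folklore] -/
theorem depletion_le_cellSet_sums (hs : 0 < s) (hK : 0 < K) {ψ : Config N → ℂ}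
    (hψ : ContDiff ℝ 1 ψ) (good : ℕ → Prop) [DecidablePred good] (Rf : ℕ → ℝ) {C w : ℝ}
    (h41 : ∀ (L : ℝ), 0 < L → ∀ (f : Space → ℂ), ContDiff ℝ 1 f →
      ∀ (Ω : Set Space), MeasurableSet Ω → Ω ⊆ cell L →
        ∫⁻ x in cell L, (‖f x - ⨍ y in cell L, f y‖₊ : ℝ≥0∞) ^ 2 ≤
          ENNReal.ofReal C *
            (ENNReal.ofReal (L ^ 2) * (∫⁻ x in Ω, gradSqC f x) +
              volume (cell L \ Ω) ^ (2 / 3 : ℝ) * ∫⁻ x in cell L, gradSqC f x))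
    (hW : ∀ m : ℕ, good (m + 1) →
      ((m : ℝ≥0∞) * (ENNReal.ofReal (Rf (m + 1)) ^ 3 * ENNReal.ofReal (Real.pi * 4 / 3))) ^
        (2 / 3 : ℝ) ≤ ENNReal.ofReal w) :
    ∑ i : Fin N, (ENNReal.ofReal ((K : ℝ) * s) ^ 3)⁻¹ * ∫⁻ X in cellN N ((K : ℝ) * s),
        ∑ q : SubIdx K, ∫⁻ x in subCell s q,
          (‖ψ (Function.update X i x) -
            ⨍ y in subCell s q, ψ (Function.update X i y)‖₊ : ℝ≥0∞) ^ 2 ≤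
      ENNReal.ofReal C * (ENNReal.ofReal (s ^ 2) *
        (∑ σ : Fin N → Fin (K ^ 3), ∫⁻ X in cellSet K s σ, ∑ i : Fin N,
          if good (Finset.univ.filter fun j => σ j = σ i).card then
            {Y : Config N | ∀ j, j ≠ i → σ j = σ i →
              Rf (Finset.univ.filter fun j => σ j = σ i).card ≤ dist (Y i) (Y j)}.indicator
              (partialGradSq i ψ) X else 0) +
        ENNReal.ofReal w *
        (∑ σ : Fin N → Fin (K ^ 3), ∫⁻ X in cellSet K s σ, ∑ i : Fin N,
          if good (Finset.univ.filter fun j => σ j = σ i).card then partialGradSq i ψ X else 0)) +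
      ∑ σ : Fin N → Fin (K ^ 3), ∫⁻ X in cellSet K s σ, ∑ i : Fin N,
        if good (Finset.univ.filter fun j => σ j = σ i).card then 0 else (‖ψ X‖₊ : ℝ≥0∞) ^ 2 := by
  -- the three bookkeeping families and their densities
  set Gout : (Fin N → Fin (K ^ 3)) → Fin N → Config N → ℝ≥0∞ := fun σ i X =>
    if good (Finset.univ.filter fun j => σ j = σ i).card then
      {Y : Config N | ∀ j, j ≠ i → σ j = σ i →
        Rf (Finset.univ.filter fun j => σ j = σ i).card ≤ dist (Y i) (Y j)}.indicator
        (partialGradSq i ψ) X else 0 with hGout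
  set Gkin : (Fin N → Fin (K ^ 3)) → Fin N → Config N → ℝ≥0∞ := fun σ i X =>
    if good (Finset.univ.filter fun j => σ j = σ i).card then partialGradSq i ψ X else 0
    with hGkin
  set Gbad : (Fin N → Fin (K ^ 3)) → Fin N → Config N → ℝ≥0∞ := fun σ i X =>
    if good (Finset.univ.filter fun j => σ j = σ i).card then 0 else (‖ψ X‖₊ : ℝ≥0∞) ^ 2
    with hGbad
  have hmGout : ∀ σ i, Measurable (Gout σ i) := fun σ i =>
    measurable_ite_const _ ((measurable_partialGradSq i ψ).indicator
      (measurableSet_farConfig σ i _)) measurable_const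
  have hmGkin : ∀ σ i, Measurable (Gkin σ i) := fun σ i =>
    measurable_ite_const _ (measurable_partialGradSq i ψ) measurable_const
  have hmGbad : ∀ σ i, Measurable (Gbad σ i) := fun σ i =>
    measurable_ite_const _ measurable_const (measurable_normSq hψ.continuous)
  set Hout : Fin N → Config N → ℝ≥0∞ := fun i Y => ∑ σ : Fin N → Fin (K ^ 3),
    {X : Config N | ∀ j, X j ∈ subCell s (cellCoord K (σ j))}.indicator (Gout σ i) Y with hHout
  set Hkin : Fin N → Config N → ℝ≥0∞ := fun i Y => ∑ σ : Fin N → Fin (K ^ 3),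
    {X : Config N | ∀ j, X j ∈ subCell s (cellCoord K (σ j))}.indicator (Gkin σ i) Y with hHkin
  set Hbad : Fin N → Config N → ℝ≥0∞ := fun i Y => ∑ σ : Fin N → Fin (K ^ 3),
    {X : Config N | ∀ j, X j ∈ subCell s (cellCoord K (σ j))}.indicator (Gbad σ i) Y with hHbad
  have hmo : ∀ i, Measurable (Hout i) := fun i =>
    Finset.measurable_sum _ fun σ _ => (hmGout σ i).indicator (measurableSet_hcellSet K s σ)
  have hmk : ∀ i, Measurable (Hkin i) := fun i =>
    Finset.measurable_sum _ fun σ _ => (hmGkin σ i).indicator (measurableSet_hcellSet K s σ)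
  have hmb : ∀ i, Measurable (Hbad i) := fun i =>
    Finset.measurable_sum _ fun σ _ => (hmGbad σ i).indicator (measurableSet_hcellSet K s σ)
  have h := depletion_le_sum_lintegral hs hK hψ good Rf h41 hW Hout Hkin Hbad hmo hmk hmb
    (fun σ i Y hY hg => by
      change (∑ τ : Fin N → Fin (K ^ 3), _) = _
      rw [sum_indicator_hcellSet_eq hs hY, hGout]; simp only [hg, if_true])
    (fun σ i Y hY hg => by
      change (∑ τ : Fin N → Fin (K ^ 3), _) = _
      rw [sum_indicator_hcellSet_eq hs hY, hGkin]; simp only [hg, if_true])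
    (fun σ i Y hY hg => by
      change (∑ τ : Fin N → Fin (K ^ 3), _) = _
      rw [sum_indicator_hcellSet_eq hs hY, hGbad]; simp only [hg, if_false])
  refine h.trans (le_of_eq ?_)
  -- linearity and re-summation
  have hlin : ∀ i : Fin N, ∫⁻ X in cellN N ((K : ℝ) * s), (ENNReal.ofReal C *
      (ENNReal.ofReal (s ^ 2) * Hout i X + ENNReal.ofReal w * Hkin i X) + Hbad i X) =
      ENNReal.ofReal C * (ENNReal.ofReal (s ^ 2) * (∫⁻ X in cellN N ((K : ℝ) * s), Hout i X) +
        ENNReal.ofReal w * ∫⁻ X in cellN N ((K : ℝ) * s), Hkin i X) +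
        ∫⁻ X in cellN N ((K : ℝ) * s), Hbad i X := by
    intro i
    have hm1 : Measurable fun X => ENNReal.ofReal (s ^ 2) * Hout i X := (hmo i).const_mul _
    have hm12 : Measurable fun X => ENNReal.ofReal (s ^ 2) * Hout i X +
        ENNReal.ofReal w * Hkin i X := hm1.add ((hmk i).const_mul _)
    have hmA : Measurable fun X => ENNReal.ofReal C * (ENNReal.ofReal (s ^ 2) * Hout i X +
        ENNReal.ofReal w * Hkin i X) := hm12.const_mul _
    rw [lintegral_add_left hmA, lintegral_const_mul' _ _ ENNReal.ofReal_ne_top,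
      lintegral_add_left hm1, lintegral_const_mul' _ _ ENNReal.ofReal_ne_top,
      lintegral_const_mul' _ _ ENNReal.ofReal_ne_top]
  simp only [hlin, Finset.sum_add_distrib, ← Finset.mul_sum]
  rw [sum_lintegral_sum_indicator_hcellSet hs hK Gout hmGout,
    sum_lintegral_sum_indicator_hcellSet hs hK Gkin hmGkin,
    sum_lintegral_sum_indicator_hcellSet hs hK Gbad hmGbad]

end SliceBound


/-! ## Part C: cell-set energy bookkeeping -/

section GroupBounds

variable {n N K : ℕ} {s : ℝ}

/-! ### The outside part of a group's kinetic energy -/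

/-- `kineticOn ι = T^in_ι + T^out_ι` pointwise, `T^out_ι = ∑_{i} 1_{(nearSetOn ι R i)ᶜ} |∇_{ι i}ψ|²`.
[folklore] -/
theorem kineticOn_eq_inside_add_outside (ι : Fin n → Fin N) (R : ℝ) (ψ : Config N → ℂ)
    (X : Config N) :
    kineticOn ι ψ X = kineticInsideOn ι R ψ X +
      ∑ i : Fin n, (nearSetOn ι R i)ᶜ.indicator (partialGradSq (ι i) ψ) X := by
  unfold kineticInsideOn
  rw [← Finset.sum_add_distrib]
  refine Finset.sum_congr rfl fun i _ => ?_
  rw [Set.indicator_self_add_compl_apply]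
  rfl

/-- The localized density of a group plus `(1-ε)` times its outside kinetic energy is at most the
group's full energy density (`0 ≤ ε ≤ 1`; the interaction only loses the factor `1-ε ≤ 1`).
[folklore] -/
theorem locDensityOn_add_outside_le (ι : Fin n → Fin N) {ε : ℝ} (hε0 : 0 ≤ ε) (hε1 : ε ≤ 1)
    (R : ℝ) (v : ℝ → ℝ≥0∞) (ψ : Config N → ℂ) (X : Config N) :
    locDensityOn ι ε R v ψ X +
        ENNReal.ofReal (1 - ε) * ∑ i : Fin n, (nearSetOn ι R i)ᶜ.indicator (partialGradSq (ι i) ψ) X ≤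
      kineticOn ι ψ X + interactionOn ι v X * (‖ψ X‖₊ : ℝ≥0∞) ^ 2 := by
  have hsplit : ENNReal.ofReal ε + ENNReal.ofReal (1 - ε) = 1 := by
    rw [← ENNReal.ofReal_add hε0 (by linarith), add_sub_cancel, ENNReal.ofReal_one]
  have hle1 : ENNReal.ofReal (1 - ε) ≤ 1 := ENNReal.ofReal_le_one.2 (by linarith)
  have hkin := kineticOn_eq_inside_add_outside ι R ψ X
  unfold locDensityOn
  calc ENNReal.ofReal ε * kineticOn ι ψ X + ENNReal.ofReal (1 - ε) *
        (kineticInsideOn ι R ψ X + interactionOn ι v X * (‖ψ X‖₊ : ℝ≥0∞) ^ 2) +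
        ENNReal.ofReal (1 - ε) * ∑ i : Fin n, (nearSetOn ι R i)ᶜ.indicator (partialGradSq (ι i) ψ) X
      = ENNReal.ofReal ε * kineticOn ι ψ X + ENNReal.ofReal (1 - ε) *
          (kineticInsideOn ι R ψ X +
            ∑ i : Fin n, (nearSetOn ι R i)ᶜ.indicator (partialGradSq (ι i) ψ) X) +
          ENNReal.ofReal (1 - ε) * (interactionOn ι v X * (‖ψ X‖₊ : ℝ≥0∞) ^ 2) := by ring1
    _ = kineticOn ι ψ X + ENNReal.ofReal (1 - ε) * (interactionOn ι v X * (‖ψ X‖₊ : ℝ≥0∞) ^ 2) := by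
          rw [← hkin, ← add_mul, hsplit, one_mul]
    _ ≤ kineticOn ι ψ X + 1 * (interactionOn ι v X * (‖ψ X‖₊ : ℝ≥0∞) ^ 2) := by gcongr
    _ = _ := by rw [one_mul]

/-! ### Group lower bounds on a cell set -/

/-- **Localized group extraction on a cell set, with the outside kinetic energy kept.** For the
group of particles assigned by `σ` to cell `c` (occupation `n_c`), `0 ≤ ε ≤ 1` and any `R`,
`E'(ε,R; n_c, s) · ∫_{cellSet σ} |ψ|² + (1-ε) ∫_{cellSet σ} T^out_c ≤ ∫_{cellSet σ} (T_c + I_c |ψ|²)`,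
`E' = locGroundStateEnergy ε R v n_c s`. [folklore] -/
theorem locGroundStateEnergy_mul_add_outside_le (σ : Fin N → Fin (K ^ 3)) (c : Fin (K ^ 3))
    {ε : ℝ} (hε0 : 0 ≤ ε) (hε1 : ε ≤ 1) (R : ℝ) {v : ℝ → ℝ≥0∞} (hv : Measurable v)
    {ψ : Config N → ℂ} (hψ : ContDiff ℝ 1 ψ) :
    locGroundStateEnergy ε R v (Finset.univ.filter fun i => σ i = c).card s *
        (∫⁻ X in cellSet K s σ, (‖ψ X‖₊ : ℝ≥0∞) ^ 2) +
      ENNReal.ofReal (1 - ε) * ∫⁻ X in cellSet K s σ,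
        ∑ i : Fin (Finset.univ.filter fun i => σ i = c).card,
          (nearSetOn ((Finset.univ.filter fun i => σ i = c).orderEmbOfFin rfl).toEmbedding R i)ᶜ.indicator
            (partialGradSq (((Finset.univ.filter fun i => σ i = c).orderEmbOfFin rfl) i) ψ) X ≤
      ∫⁻ X in cellSet K s σ,
        kineticOn ((Finset.univ.filter fun i => σ i = c).orderEmbOfFin rfl) ψ X +
          interactionOn ((Finset.univ.filter fun i => σ i = c).orderEmbOfFin rfl) v X *
            (‖ψ X‖₊ : ℝ≥0∞) ^ 2 := by
  set ι := ((Finset.univ.filter fun i => σ i = c).orderEmbOfFin rfl).toEmbedding with hι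
  have h := locGroundStateEnergy_mul_le_setLIntegral_group ι (cellCorner K s c) ε R s hv hψ
    {Z | ∀ j, Z j - cellCorner K s (σ j) ∈ box s}
  rw [setOf_group_eq_cellSet K s σ c] at h
  have hm : Measurable (locDensityOn ι ε R v ψ) := measurable_locDensityOn ι ε R hv hψ
  calc _ ≤ (∫⁻ X in cellSet K s σ, locDensityOn ι ε R v ψ X) +
        ENNReal.ofReal (1 - ε) * ∫⁻ X in cellSet K s σ,
          ∑ i, (nearSetOn ι R i)ᶜ.indicator (partialGradSq (ι i) ψ) X := add_le_add h le_rfl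
    _ = ∫⁻ X in cellSet K s σ, (locDensityOn ι ε R v ψ X +
        ENNReal.ofReal (1 - ε) * ∑ i, (nearSetOn ι R i)ᶜ.indicator (partialGradSq (ι i) ψ) X) := by
        rw [lintegral_add_left hm, lintegral_const_mul' _ _ ENNReal.ofReal_ne_top]
    _ ≤ _ := lintegral_mono fun X => locDensityOn_add_outside_le ι hε0 hε1 R v ψ X

/-- **Plain group extraction on a cell set**: `E₀^Neu(n_c, s) · ∫_{cellSet σ} |ψ|² ≤
∫_{cellSet σ} (T_c + I_c |ψ|²)`. [folklore] -/
theorem neumannGroundStateEnergy_mul_le_cellSet (σ : Fin N → Fin (K ^ 3)) (c : Fin (K ^ 3))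
    {v : ℝ → ℝ≥0∞} (hv : Measurable v) {ψ : Config N → ℂ} (hψ : ContDiff ℝ 1 ψ) :
    neumannGroundStateEnergy v (Finset.univ.filter fun i => σ i = c).card s *
        (∫⁻ X in cellSet K s σ, (‖ψ X‖₊ : ℝ≥0∞) ^ 2) ≤
      ∫⁻ X in cellSet K s σ,
        kineticOn ((Finset.univ.filter fun i => σ i = c).orderEmbOfFin rfl) ψ X +
          interactionOn ((Finset.univ.filter fun i => σ i = c).orderEmbOfFin rfl) v X *
            (‖ψ X‖₊ : ℝ≥0∞) ^ 2 := by
  have h := neumannGroundStateEnergy_mul_le_setLIntegral_group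
    ((Finset.univ.filter fun i => σ i = c).orderEmbOfFin rfl).toEmbedding (cellCorner K s c) s
    hv hψ {Z | ∀ j, Z j - cellCorner K s (σ j) ∈ box s}
  rw [setOf_group_eq_cellSet K s σ c] at h
  exact h

/-- **The groups' energies add up to at most the energy**: for a Dirichlet state of `Λ_L`,
`L = Ks`, `∑_σ ∑_c ∫_{cellSet σ} (T_c + I_c |Ψ|²) ≤ ⟨Ψ, H_N Ψ⟩`. [folklore] -/
theorem sum_sum_groupEnergy_le_energy {L : ℝ} (hs : 0 < s)
    {v : ℝ → ℝ≥0∞} (hv : Measurable v) (Ψ : TrialState N L) :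
    ∑ σ : Fin N → Fin (K ^ 3), ∑ c : Fin (K ^ 3), ∫⁻ X in cellSet K s σ,
        kineticOn ((Finset.univ.filter fun i => σ i = c).orderEmbOfFin rfl) Ψ.ψ X +
          interactionOn ((Finset.univ.filter fun i => σ i = c).orderEmbOfFin rfl) v X *
            (‖Ψ.ψ X‖₊ : ℝ≥0∞) ^ 2 ≤ energy v Ψ := by
  have hF : ∀ (σ : Fin N → Fin (K ^ 3)) (c : Fin (K ^ 3)), Measurable fun X =>
      kineticOn ((Finset.univ.filter fun i => σ i = c).orderEmbOfFin rfl) Ψ.ψ X +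
        interactionOn ((Finset.univ.filter fun i => σ i = c).orderEmbOfFin rfl) v X *
          (‖Ψ.ψ X‖₊ : ℝ≥0∞) ^ 2 := fun σ c =>
    (measurable_kineticOn _ Ψ.contDiff).add ((measurable_interactionOn _ hv).mul
      (measurable_normSq Ψ.contDiff.continuous))
  calc _ ≤ ∑ σ : Fin N → Fin (K ^ 3), ∫⁻ X in cellSet K s σ,
          kineticDensity Ψ.ψ X + interaction v X * (‖Ψ.ψ X‖₊ : ℝ≥0∞) ^ 2 := by
        refine Finset.sum_le_sum fun σ _ => ?_
        rw [← lintegral_finsetSum _ fun c _ => hF σ c]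
        refine lintegral_mono fun X => ?_
        rw [Finset.sum_add_distrib, ← Finset.sum_mul, ← kineticDensity_eq_sum_kineticOn σ Ψ.ψ X]
        gcongr
        exact sum_interactionOn_le_interaction σ v X
    _ = ∫⁻ X in ⋃ σ : Fin N → Fin (K ^ 3), cellSet K s σ,
          kineticDensity Ψ.ψ X + interaction v X * (‖Ψ.ψ X‖₊ : ℝ≥0∞) ^ 2 := by
        rw [lintegral_iUnion (fun σ => measurableSet_cellSet K s σ) (pairwiseDisjoint_cellSet hs),
          tsum_fintype]
    _ ≤ energy v Ψ := setLIntegral_le_lintegral _ _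

/-- **The masses of the cell sets add up to one** for a Dirichlet state of `Λ_L`, `L = Ks`.
[folklore] -/
theorem sum_mass_cellSet_eq_one {L : ℝ} (hs : 0 < s) (hK : 0 < K) (hKs : (K : ℝ) * s = L)
    (Ψ : TrialState N L) :
    ∑ σ : Fin N → Fin (K ^ 3), ∫⁻ X in cellSet K s σ, (‖Ψ.ψ X‖₊ : ℝ≥0∞) ^ 2 = 1 := by
  calc ∑ σ : Fin N → Fin (K ^ 3), ∫⁻ X in cellSet K s σ, (‖Ψ.ψ X‖₊ : ℝ≥0∞) ^ 2
      = ∫⁻ X in ⋃ σ : Fin N → Fin (K ^ 3), cellSet K s σ, (‖Ψ.ψ X‖₊ : ℝ≥0∞) ^ 2 := by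
        rw [lintegral_iUnion (fun σ => measurableSet_cellSet K s σ) (pairwiseDisjoint_cellSet hs),
          tsum_fintype]
    _ = ∫⁻ X in boxN N ((K : ℝ) * s), (‖Ψ.ψ X‖₊ : ℝ≥0∞) ^ 2 :=
        (setLIntegral_congr (boxN_ae_eq_iUnion_cellSet (N := N) hs hK)).symm
    _ = ∫⁻ X, (‖Ψ.ψ X‖₊ : ℝ≥0∞) ^ 2 := by
        rw [hKs]
        refine setLIntegral_eq_of_support_subset fun X hX => ?_
        by_contra h
        exact hX (by simp [Ψ.eq_zero X h])
    _ = 1 := Ψ.norm_eq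

/-! ### Fibrewise re-indexing -/

/-- A sum over the particles is a sum over the cells of sums over the groups, each group
enumerated increasingly. [folklore] -/
theorem sum_eq_sum_fiber_orderEmb (σ : Fin N → Fin (K ^ 3)) (F : Fin N → ℝ≥0∞) :
    ∑ i : Fin N, F i = ∑ c : Fin (K ^ 3), ∑ i : Fin (Finset.univ.filter fun j => σ j = c).card,
      F (((Finset.univ.filter fun j => σ j = c).orderEmbOfFin rfl) i) := by
  rw [← Finset.sum_fiberwise Finset.univ σ]
  refine Finset.sum_congr rfl fun c _ => ?_
  set t := Finset.univ.filter fun j => σ j = c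
  rw [← Finset.sum_coe_sort t]
  exact (Fintype.sum_equiv (t.orderIsoOfFin rfl).toEquiv _ _ fun i => rfl).symm

/-- Members of the group of cell `c` are assigned to `c`. [folklore] -/
theorem apply_orderEmbOfFin_eq (σ : Fin N → Fin (K ^ 3)) (c : Fin (K ^ 3))
    (i : Fin (Finset.univ.filter fun j => σ j = c).card) :
    σ (((Finset.univ.filter fun j => σ j = c).orderEmbOfFin rfl) i) = c := by
  have h := Finset.orderEmbOfFin_mem (Finset.univ.filter fun j => σ j = c) rfl i
  rw [Finset.mem_filter] at h
  exact h.2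

/-- The same-cell far region of a group member is the complement of its within-group encounter
region. [folklore] -/
theorem mem_farConfig_iff_not_mem_nearSetOn (σ : Fin N → Fin (K ^ 3)) (c : Fin (K ^ 3)) (R : ℝ)
    (i : Fin (Finset.univ.filter fun j => σ j = c).card) (X : Config N) :
    X ∈ {Y : Config N | ∀ j, j ≠ ((Finset.univ.filter fun j => σ j = c).orderEmbOfFin rfl) i →
        σ j = σ (((Finset.univ.filter fun j => σ j = c).orderEmbOfFin rfl) i) →
          R ≤ dist (Y (((Finset.univ.filter fun j => σ j = c).orderEmbOfFin rfl) i)) (Y j)} ↔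
      X ∉ nearSetOn ((Finset.univ.filter fun j => σ j = c).orderEmbOfFin rfl).toEmbedding R i := by
  set t := Finset.univ.filter fun j => σ j = c with ht
  set ι := t.orderEmbOfFin rfl with hι
  have hιc : ∀ i', σ (ι i') = c := apply_orderEmbOfFin_eq σ c
  have hrange : ∀ j : Fin N, σ j = c → ∃ i', ι i' = j := by
    intro j hj
    have : j ∈ Set.range ι := by
      rw [hι, Finset.range_orderEmbOfFin]; simp [ht, hj]
    exact this
  simp only [Set.mem_setOf_eq, nearSetOn, not_exists, not_and, not_lt]
  constructor
  · intro h j' hj'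
    exact h (ι j') (fun heq => hj' (ι.injective heq)) (by rw [hιc, hιc])
  · intro h j hj hσj
    obtain ⟨j', rfl⟩ := hrange j (by rw [hσj, hιc])
    exact h j' (fun heq => hj (by rw [heq]))


end GroupBounds


/-! ## Part M: the deterministic floor inequality -/

section Main

variable {n K : ℕ} {s L : ℝ}

local notation "fib[" σ ", " c "]" => (Finset.univ.filter fun i => σ i = c)

/-- Switching a finite sum on or off. [folklore] -/
theorem sum_ite_const_zero {ι : Type*} (t : Finset ι) (p : Prop) [Decidable p] (f : ι → ℝ≥0∞) :
    ∑ i ∈ t, (if p then f i else 0) = if p then ∑ i ∈ t, f i else 0 := by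
  by_cases hp : p <;> simp [hp]

/-- Switching an integral on or off. [folklore] -/
theorem lintegral_ite_const_zero {α : Type*} [MeasurableSpace α] (μ : Measure α) (p : Prop)
    [Decidable p] (f : α → ℝ≥0∞) :
    ∫⁻ x, (if p then f x else 0) ∂μ = if p then ∫⁻ x, f x ∂μ else 0 := by
  by_cases hp : p <;> simp [hp]

/-- **The deterministic floor inequality.**  Let `Ψ` be a Dirichlet state of `Λ_L`, `L = Ks`,
with energy `≤ U`.  Classify occupation numbers `m` of cells of side `s` into `good` ones — for
which the localized cell functional is bounded below, `lb(m) ≤ E'(y(m), R(m); m, s)` with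
`y(m) ≤ 1/2`, and the excluded volume `(m-1)·(4π/3)R(m)³` has `(·)^{2/3} ≤ w` — and the others,
for which `lb(m) ≤ E₀^Neu(m, s)`.  Suppose the occupation bookkeeping
`A + κ · #{particles in cells that are not good} ≤ ∑_c lb(n_c) + B` holds for every distribution
of the `N` particles over the `K³` cells, that `2 C s² κ ≥ 1` (`C` the constant of Lemma 4.1), and
the budget `2 C s² (U + B - A) + C w U ≤ N/8`.  Then the `K³` sub-cell constant modes carry at
least `7N/8` particles: `7N/8 ≤ ∑_q ⟨u_q, γ_Ψ u_q⟩` (LSSY's mechanism (5.15)–(5.17) run cell by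
cell on a big Dirichlet box, with Lemma 5.2's localized lower bound cell by cell and a
configuration-dependent excluded volume). [folklore] -/
theorem seven_eighths_le_sum_occupation (hs : 0 < s) (hK : 0 < K) (hKs : (K : ℝ) * s = L)
    (hL : 0 < L) {v : ℝ → ℝ≥0∞} (hv : Measurable v) (Ψ : TrialState (n + 1) L)
    (good : ℕ → Prop) [DecidablePred good] (Rf yf lb : ℕ → ℝ) {C w Ur A B κ : ℝ}
    (hC : 0 ≤ C) (hw : 0 ≤ w) (hUr : 0 ≤ Ur) (hA : 0 ≤ A) (hB : 0 ≤ B)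
    (h41 : ∀ (L : ℝ), 0 < L → ∀ (f : Space → ℂ), ContDiff ℝ 1 f →
      ∀ (Ω : Set Space), MeasurableSet Ω → Ω ⊆ cell L →
        ∫⁻ x in cell L, (‖f x - ⨍ y in cell L, f y‖₊ : ℝ≥0∞) ^ 2 ≤
          ENNReal.ofReal C *
            (ENNReal.ofReal (L ^ 2) * (∫⁻ x in Ω, gradSqC f x) +
              volume (cell L \ Ω) ^ (2 / 3 : ℝ) * ∫⁻ x in cell L, gradSqC f x))
    (hW : ∀ m : ℕ, good (m + 1) →
      ((m : ℝ≥0∞) * (ENNReal.ofReal (Rf (m + 1)) ^ 3 * ENNReal.ofReal (Real.pi * 4 / 3))) ^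
        (2 / 3 : ℝ) ≤ ENNReal.ofReal w)
    (hy : ∀ m, good m → 0 ≤ yf m ∧ yf m ≤ 1 / 2)
    (hloc : ∀ m, good m → ENNReal.ofReal (lb m) ≤ locGroundStateEnergy (yf m) (Rf m) v m s)
    (hE0 : ∀ m, ¬ good m → ENNReal.ofReal (lb m) ≤ neumannGroundStateEnergy v m s)
    (hcomb : ∀ nv : Fin (K ^ 3) → ℕ, ∑ c, nv c = n + 1 →
      ENNReal.ofReal A + ENNReal.ofReal κ * ∑ c, (if good (nv c) then 0 else (nv c : ℝ≥0∞)) ≤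
        (∑ c, ENNReal.ofReal (lb (nv c))) + ENNReal.ofReal B)
    (hκ : 1 ≤ 2 * C * s ^ 2 * κ) (hE : energy v Ψ ≤ ENNReal.ofReal Ur) (hUBA : A ≤ Ur + B)
    (hbudget : 2 * C * s ^ 2 * (Ur + B - A) + C * w * Ur ≤ (n + 1) / 8) :
    ENNReal.ofReal (7 * (n + 1) / 8) ≤ ∑ q : SubIdx K, occupation (n + 1) (subMode s q) Ψ.ψ := by
  have hcont : Continuous Ψ.ψ := Ψ.contDiff.continuous
  -- abbreviations: mass, group energy, outside kinetic energy of a group, per assignment and cell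
  set mass : (Fin (n + 1) → Fin (K ^ 3)) → ℝ≥0∞ := fun σ =>
    ∫⁻ X in cellSet K s σ, (‖Ψ.ψ X‖₊ : ℝ≥0∞) ^ 2 with hmass
  set Egrp : (Fin (n + 1) → Fin (K ^ 3)) → Fin (K ^ 3) → ℝ≥0∞ := fun σ c =>
    ∫⁻ X in cellSet K s σ, kineticOn (fib[σ, c].orderEmbOfFin rfl) Ψ.ψ X +
      interactionOn (fib[σ, c].orderEmbOfFin rfl) v X * (‖Ψ.ψ X‖₊ : ℝ≥0∞) ^ 2 with hEgrp
  set fout : (Fin (n + 1) → Fin (K ^ 3)) → Fin (K ^ 3) → Config (n + 1) → ℝ≥0∞ := fun σ c X =>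
    ∑ i : Fin fib[σ, c].card, (nearSetOn (fib[σ, c].orderEmbOfFin rfl).toEmbedding
      (Rf fib[σ, c].card) i)ᶜ.indicator (partialGradSq ((fib[σ, c].orderEmbOfFin rfl) i) Ψ.ψ) X
    with hfout
  have hmfout : ∀ σ c, Measurable (fout σ c) := fun σ c =>
    Finset.measurable_sum _ fun i _ =>
      (measurable_partialGradSq _ Ψ.ψ).indicator (measurableSet_nearSetOn _ _ i).compl
  set Nbad : (Fin (n + 1) → Fin (K ^ 3)) → ℝ≥0∞ := fun σ =>
    ∑ c, (if good fib[σ, c].card then 0 else (fib[σ, c].card : ℝ≥0∞)) with hNbad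
  set 𝒯 : ℝ≥0∞ := ∑ σ : Fin (n + 1) → Fin (K ^ 3), ∑ c,
    (if good fib[σ, c].card then ∫⁻ X in cellSet K s σ, fout σ c X else 0) with h𝒯
  set 𝒩 : ℝ≥0∞ := ∑ σ : Fin (n + 1) → Fin (K ^ 3), Nbad σ * mass σ with h𝒩
  have hsum_card : ∀ σ : Fin (n + 1) → Fin (K ^ 3), ∑ c, fib[σ, c].card = n + 1 := fun σ =>
    (Finset.card_eq_sum_card_fiberwise (f := σ) (s := Finset.univ) (t := Finset.univ)
      fun _ _ => Finset.mem_univ _).symm.trans (by simp)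
  ----------------------------------------------------------------
  -- Step 1: the depletion identity and the slice bound
  ----------------------------------------------------------------
  have hid := occupation_add_depletion_eq hs hL hKs Ψ
  have hdep := depletion_le_cellSet_sums (N := n + 1) hs hK Ψ.contDiff good Rf h41 hW
  rw [hKs] at hdep
  -- Step 2: fibrewise rewriting of the three particle sums
  have hout_pt : ∀ (σ : Fin (n + 1) → Fin (K ^ 3)) (X : Config (n + 1)),
      (∑ i : Fin (n + 1), if good fib[σ, σ i].card then
        {Y : Config (n + 1) | ∀ j, j ≠ i → σ j = σ i →
          Rf fib[σ, σ i].card ≤ dist (Y i) (Y j)}.indicator (partialGradSq i Ψ.ψ) X else 0) =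
      ∑ c, (if good fib[σ, c].card then fout σ c X else 0) := by
    intro σ X
    rw [sum_eq_sum_fiber_orderEmb σ]
    refine Finset.sum_congr rfl fun c _ => ?_
    rw [hfout, ← sum_ite_const_zero]
    refine Finset.sum_congr rfl fun i _ => ?_
    rw [apply_orderEmbOfFin_eq σ c i]
    by_cases hg : good fib[σ, c].card
    · simp only [hg, if_true]
      by_cases hX : X ∈ nearSetOn (fib[σ, c].orderEmbOfFin rfl).toEmbedding (Rf fib[σ, c].card) i
      · rw [Set.indicator_of_notMem (fun h => ((mem_farConfig_iff_not_mem_nearSetOn σ c _ i X).1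
          (by rw [apply_orderEmbOfFin_eq σ c i]; exact h)) hX),
          Set.indicator_of_notMem (fun h => (Set.mem_compl_iff _ _).1 h hX)]
      · rw [Set.indicator_of_mem (show X ∈ _ from by
            have := (mem_farConfig_iff_not_mem_nearSetOn σ c (Rf fib[σ, c].card) i X).2 hX
            rw [apply_orderEmbOfFin_eq σ c i] at this; exact this),
          Set.indicator_of_mem (show X ∈ (nearSetOn _ _ i)ᶜ from hX)]
    · simp only [hg, if_false]
  have hkin_pt : ∀ (σ : Fin (n + 1) → Fin (K ^ 3)) (X : Config (n + 1)),
      (∑ i : Fin (n + 1), if good fib[σ, σ i].card then partialGradSq i Ψ.ψ X else 0) =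
      ∑ c, (if good fib[σ, c].card then kineticOn (fib[σ, c].orderEmbOfFin rfl) Ψ.ψ X else 0) := by
    intro σ X
    rw [sum_eq_sum_fiber_orderEmb σ]
    refine Finset.sum_congr rfl fun c _ => ?_
    simp only [apply_orderEmbOfFin_eq σ c, sum_ite_const_zero]
    rfl
  have hbad_pt : ∀ (σ : Fin (n + 1) → Fin (K ^ 3)) (X : Config (n + 1)),
      (∑ i : Fin (n + 1), if good fib[σ, σ i].card then (0 : ℝ≥0∞) else (‖Ψ.ψ X‖₊ : ℝ≥0∞) ^ 2) =
      Nbad σ * (‖Ψ.ψ X‖₊ : ℝ≥0∞) ^ 2 := by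
    intro σ X
    rw [sum_eq_sum_fiber_orderEmb σ, hNbad, Finset.sum_mul]
    refine Finset.sum_congr rfl fun c _ => ?_
    simp only [apply_orderEmbOfFin_eq σ c]
    by_cases hg : good fib[σ, c].card
    · simp [hg]
    · simp [hg]
  simp only [hout_pt, hkin_pt, hbad_pt] at hdep
  ----------------------------------------------------------------
  -- Step 3: identify the three terms of the slice bound
  ----------------------------------------------------------------
  have hT_eq : ∀ σ : Fin (n + 1) → Fin (K ^ 3),
      ∫⁻ X in cellSet K s σ, ∑ c, (if good fib[σ, c].card then fout σ c X else 0) =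
        ∑ c, (if good fib[σ, c].card then ∫⁻ X in cellSet K s σ, fout σ c X else 0) := by
    intro σ
    rw [lintegral_finsetSum _ fun c _ => measurable_ite_const _ (hmfout σ c) measurable_const]
    exact Finset.sum_congr rfl fun c _ => lintegral_ite_const_zero _ _ _
  have hN_eq : ∀ σ : Fin (n + 1) → Fin (K ^ 3),
      ∫⁻ X in cellSet K s σ, Nbad σ * (‖Ψ.ψ X‖₊ : ℝ≥0∞) ^ 2 = Nbad σ * mass σ := fun σ =>
    lintegral_const_mul _ (measurable_normSq hcont)
  have hEgrp_m : ∀ (σ : Fin (n + 1) → Fin (K ^ 3)) (c : Fin (K ^ 3)), Measurable fun X =>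
      kineticOn (fib[σ, c].orderEmbOfFin rfl) Ψ.ψ X +
        interactionOn (fib[σ, c].orderEmbOfFin rfl) v X * (‖Ψ.ψ X‖₊ : ℝ≥0∞) ^ 2 := fun σ c =>
    (measurable_kineticOn _ Ψ.contDiff).add ((measurable_interactionOn _ hv).mul
      (measurable_normSq hcont))
  have hEsum : ∑ σ : Fin (n + 1) → Fin (K ^ 3), ∑ c, Egrp σ c ≤ ENNReal.ofReal Ur :=
    (sum_sum_groupEnergy_le_energy hs hv Ψ).trans hE
  have hK_le : ∑ σ : Fin (n + 1) → Fin (K ^ 3), ∫⁻ X in cellSet K s σ,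
      ∑ c, (if good fib[σ, c].card then kineticOn (fib[σ, c].orderEmbOfFin rfl) Ψ.ψ X else 0) ≤
        ENNReal.ofReal Ur := by
    refine le_trans (Finset.sum_le_sum fun σ _ => ?_) hEsum
    rw [hEgrp, ← lintegral_finsetSum _ fun c _ => hEgrp_m σ c]
    refine lintegral_mono fun X => Finset.sum_le_sum fun c _ => ?_
    by_cases hg : good fib[σ, c].card
    · simp only [hg, if_true]; exact le_self_add
    · simp only [hg, if_false]; exact bot_le
  simp only [hT_eq, hN_eq] at hdep
  -- now: hdep : D ≤ C (s² 𝒯 + w 𝒦') + 𝒩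
  ----------------------------------------------------------------
  -- Step 4: energy bookkeeping per group
  ----------------------------------------------------------------
  have hgrp : ∀ (σ : Fin (n + 1) → Fin (K ^ 3)) (c : Fin (K ^ 3)),
      ENNReal.ofReal (lb fib[σ, c].card) * mass σ +
        ENNReal.ofReal (1 / 2) * (if good fib[σ, c].card then ∫⁻ X in cellSet K s σ, fout σ c X
          else 0) ≤ Egrp σ c := by
    intro σ c
    by_cases hg : good fib[σ, c].card
    · obtain ⟨hy0, hy1⟩ := hy _ hg
      have h := locGroundStateEnergy_mul_add_outside_le σ c hy0 (by linarith) (Rf fib[σ, c].card)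
        hv Ψ.contDiff (K := K) (s := s)
      simp only [hg, if_true]
      refine le_trans (add_le_add (mul_le_mul_left (hloc _ hg) _)
        (mul_le_mul_left (ENNReal.ofReal_le_ofReal (by linarith)) _)) h
    · simp only [hg, if_false, mul_zero, add_zero]
      exact le_trans (mul_le_mul_left (hE0 _ hg) _)
        (neumannGroundStateEnergy_mul_le_cellSet σ c hv Ψ.contDiff)
  set Λ : ℝ≥0∞ := ∑ σ : Fin (n + 1) → Fin (K ^ 3), (∑ c, ENNReal.ofReal (lb fib[σ, c].card)) * mass σ
    with hΛ
  have h4 : Λ + ENNReal.ofReal (1 / 2) * 𝒯 ≤ ENNReal.ofReal Ur := by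
    refine le_trans (le_of_eq ?_) ((Finset.sum_le_sum fun σ _ => Finset.sum_le_sum fun c _ =>
      hgrp σ c).trans hEsum)
    rw [hΛ, h𝒯, Finset.mul_sum, ← Finset.sum_add_distrib]
    refine Finset.sum_congr rfl fun σ _ => ?_
    rw [Finset.sum_mul, Finset.mul_sum, ← Finset.sum_add_distrib]
  have h4c : ENNReal.ofReal A + ENNReal.ofReal κ * 𝒩 ≤ Λ + ENNReal.ofReal B := by
    have hmass1 : ∑ σ : Fin (n + 1) → Fin (K ^ 3), mass σ = 1 := sum_mass_cellSet_eq_one hs hK hKs Ψ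
    have hσ : ∀ σ : Fin (n + 1) → Fin (K ^ 3),
        (ENNReal.ofReal A + ENNReal.ofReal κ * Nbad σ) * mass σ ≤
          ((∑ c, ENNReal.ofReal (lb fib[σ, c].card)) + ENNReal.ofReal B) * mass σ := fun σ =>
      mul_le_mul_left (hcomb (fun c => fib[σ, c].card) (hsum_card σ)) _
    have := Finset.sum_le_sum fun σ (_ : σ ∈ Finset.univ) => hσ σ
    calc ENNReal.ofReal A + ENNReal.ofReal κ * 𝒩
        = ∑ σ : Fin (n + 1) → Fin (K ^ 3), (ENNReal.ofReal A + ENNReal.ofReal κ * Nbad σ) * mass σ := by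
          rw [h𝒩, Finset.mul_sum]
          simp only [add_mul, Finset.sum_add_distrib, ← Finset.mul_sum, hmass1, mul_one, mul_assoc]
      _ ≤ ∑ σ : Fin (n + 1) → Fin (K ^ 3),
          ((∑ c, ENNReal.ofReal (lb fib[σ, c].card)) + ENNReal.ofReal B) * mass σ := this
      _ = Λ + ENNReal.ofReal B := by
          rw [hΛ]
          simp only [add_mul, Finset.sum_add_distrib, ← Finset.mul_sum, hmass1, mul_one]
  have h4d : ENNReal.ofReal A + (ENNReal.ofReal κ * 𝒩 + ENNReal.ofReal (1 / 2) * 𝒯) ≤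
      ENNReal.ofReal (Ur + B) := by
    calc ENNReal.ofReal A + (ENNReal.ofReal κ * 𝒩 + ENNReal.ofReal (1 / 2) * 𝒯)
        = (ENNReal.ofReal A + ENNReal.ofReal κ * 𝒩) + ENNReal.ofReal (1 / 2) * 𝒯 := by ring1
      _ ≤ (Λ + ENNReal.ofReal B) + ENNReal.ofReal (1 / 2) * 𝒯 := add_le_add h4c le_rfl
      _ = (Λ + ENNReal.ofReal (1 / 2) * 𝒯) + ENNReal.ofReal B := by ring1
      _ ≤ ENNReal.ofReal Ur + ENNReal.ofReal B := add_le_add h4 le_rfl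
      _ = ENNReal.ofReal (Ur + B) := (ENNReal.ofReal_add hUr hB).symm
  ----------------------------------------------------------------
  -- Step 5: the depletion is at most N/8
  ----------------------------------------------------------------
  have hX : ENNReal.ofReal κ * 𝒩 + ENNReal.ofReal (1 / 2) * 𝒯 ≤ ENNReal.ofReal (Ur + B - A) := by
    rw [ENNReal.ofReal_sub _ hA]
    exact ENNReal.le_sub_of_add_le_left ENNReal.ofReal_ne_top h4d
  have hCs : 0 ≤ 2 * C * s ^ 2 := by positivity
  have hD : ∑ i : Fin (n + 1), (ENNReal.ofReal L ^ 3)⁻¹ * ∫⁻ X in cellN (n + 1) L,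
      ∑ q : SubIdx K, ∫⁻ x in subCell s q, (‖Ψ.ψ (Function.update X i x) -
        ⨍ y in subCell s q, Ψ.ψ (Function.update X i y)‖₊ : ℝ≥0∞) ^ 2 ≤
      ENNReal.ofReal ((n + 1) / 8) := by
    refine hdep.trans ?_
    have h1 : ENNReal.ofReal C * (ENNReal.ofReal (s ^ 2) * 𝒯 + ENNReal.ofReal w *
        ∑ σ : Fin (n + 1) → Fin (K ^ 3), ∫⁻ X in cellSet K s σ, ∑ c,
          (if good fib[σ, c].card then kineticOn (fib[σ, c].orderEmbOfFin rfl) Ψ.ψ X else 0)) ≤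
        ENNReal.ofReal (2 * C * s ^ 2) * (ENNReal.ofReal (1 / 2) * 𝒯) +
          ENNReal.ofReal (C * w * Ur) := by
      calc _ ≤ ENNReal.ofReal C * (ENNReal.ofReal (s ^ 2) * 𝒯 + ENNReal.ofReal w * ENNReal.ofReal Ur) := by
            gcongr
        _ = _ := by
            rw [mul_add, ← mul_assoc, ← mul_assoc, ← mul_assoc, ← ENNReal.ofReal_mul hC,
              ← ENNReal.ofReal_mul hCs, ← ENNReal.ofReal_mul hC, ← ENNReal.ofReal_mul (by positivity)]
            congr 2; congr 1; ring
    have h2 : 𝒩 ≤ ENNReal.ofReal (2 * C * s ^ 2) * (ENNReal.ofReal κ * 𝒩) := by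
      rw [← mul_assoc, ← ENNReal.ofReal_mul hCs]
      exact le_mul_of_one_le_left bot_le (ENNReal.one_le_ofReal.2 hκ)
    calc _ ≤ ENNReal.ofReal (2 * C * s ^ 2) * (ENNReal.ofReal (1 / 2) * 𝒯) +
          ENNReal.ofReal (C * w * Ur) + ENNReal.ofReal (2 * C * s ^ 2) * (ENNReal.ofReal κ * 𝒩) :=
          add_le_add h1 h2
      _ = ENNReal.ofReal (2 * C * s ^ 2) * (ENNReal.ofReal κ * 𝒩 + ENNReal.ofReal (1 / 2) * 𝒯) +
          ENNReal.ofReal (C * w * Ur) := by ring1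
      _ ≤ ENNReal.ofReal (2 * C * s ^ 2) * ENNReal.ofReal (Ur + B - A) +
          ENNReal.ofReal (C * w * Ur) := by gcongr
      _ = ENNReal.ofReal (2 * C * s ^ 2 * (Ur + B - A) + C * w * Ur) := by
          rw [← ENNReal.ofReal_mul hCs, ← ENNReal.ofReal_add (by nlinarith) (by positivity)]
      _ ≤ ENNReal.ofReal ((n + 1) / 8) := ENNReal.ofReal_le_ofReal hbudget
  ----------------------------------------------------------------
  -- Step 6: conclude from the identity
  ----------------------------------------------------------------
  have hsplit : ((n + 1 : ℕ) : ℝ≥0∞) = ENNReal.ofReal (7 * (n + 1) / 8) + ENNReal.ofReal ((n + 1) / 8) := by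
    rw [← ENNReal.ofReal_add (by positivity) (by positivity), ← ENNReal.ofReal_natCast]
    congr 1; push_cast; ring1
  have hfin : ENNReal.ofReal (7 * (n + 1) / 8) + ENNReal.ofReal ((n + 1) / 8) ≤
      (∑ q : SubIdx K, occupation (n + 1) (subMode s q) Ψ.ψ) + ENNReal.ofReal ((n + 1) / 8) := by
    rw [← hsplit, ← hid]
    exact add_le_add le_rfl hD
  exact (ENNReal.add_le_add_iff_right ENNReal.ofReal_ne_top).1 hfin

end Main


/-! ## Dyadic indexing: sub-cell modes of side `L/2^k` are the dyadic flat modes -/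

section Dyadic

/-- The sub-cell of side `L/2^k` with index `q` is the dyadic cell of level `k` with index `q`.
[folklore] -/
theorem subCell_div_two_pow_eq_dyCell (L : ℝ) (k : ℕ) (q : SubIdx (2 ^ k)) :
    subCell (L / 2 ^ k) q = dyCell L k q := by
  ext x
  rw [mem_subCell, mem_dyCell_iff]
  refine forall_congr' fun i => ?_
  constructor <;> rintro ⟨h1, h2⟩ <;> constructor <;> linarith

/-- The sub-cell constant modes of side `L/2^k` are the dyadic flat modes of level `k`. [folklore] -/
theorem subMode_div_two_pow_eq_dyMode (L : ℝ) (k : ℕ) (q : SubIdx (2 ^ k)) :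
    subMode (L / 2 ^ k) q = dyMode L k q := by
  rw [subMode_eq_indicator, subCell_div_two_pow_eq_dyCell]
  rfl

/-- **The sub-cell occupations of side `L/2^k` sum to the dyadic coherent sum of level `k`.**
[folklore] -/
theorem sum_occupation_subMode_eq_cohSum (N : ℕ) (L : ℝ) (k : ℕ) (ψ : Config N → ℂ) :
    ∑ q : SubIdx (2 ^ k), occupation N (subMode (L / 2 ^ k) q) ψ = cohSum N L k ψ := by
  simp only [cohSum, subMode_div_two_pow_eq_dyMode]

end Dyadic

end Literature.MathematicalPhysics.QuantumManyBody.BoseGas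

end
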